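import Literature.Computability.Complexity.StackBaseSearch
import Literature.Computability.Complexity.StackIsqrt
import Literature.Computability.Complexity.StackRadixSort
import HarnessLib

/-!
# Harvey's Algorithm 2 (the main search) on the stack machine

Literature / complexity toolkit, continuing `StackBaseSearch.lean`.  This file runs the main search
of Harvey's deterministic `N^{1/5+o(1)}` factoring algorithm (arXiv:2010.05450, Algorithm 2 /
Prop. 15 = Math. Comp. Prop. 4.2) on the stack register machine, for a modulus `N` (odd, on the
ambient register `MD`), a base `α`, and parameters `m`, `r`:

* Step 1 (`a2Pow`, **`runs_a2Pow`**): the scan of `gcd(α^i − 1, N)`, `1 ≤ i < m`;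
* Step 2–3, the two lists as *sortable words* `enc v ++ 0^{|enc N| − |enc v|} ++ tag :: payload`
  (`mkWord`; the key of a word is its value): the baby steps `(C α^i, i)`, `i < m` (`a2Baby`,
  **`runs_a2Baby`**) and the giant steps `(ṽ_{a,b,j}, a, b, j)` over the pairs `1 ≤ ab ≤ r`
  (`a2Giants`, **`runs_a2Giants`**; `t_{a,b} = α^{aN + b − ⌈√(4abN)⌉}` by `powMod` with the
  integer square root of `StackIsqrt.lean`, `J_{a,b} = ⌊(⌊√N⌋+1) / (4rm⌊√(ab)⌋)⌋ + 1` giant steps).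
  The search is made *inverse-free* by multiplying everything by `C = α^{J* m}`
  (`J* = J_{1,1} ≥ J_{a,b}`): the giant-step value is `ṽ_{a,b,j} = t_{a,b} · α^{(J* − j) m}`
  instead of Harvey's `t_{a,b} · α^{−jm}`, and the baby-step value is `C α^i`;
* the sort-and-match: one LSD radix sort of the tagged union of both lists (`a2Sort`, the sorter of
  `StackRadixSort.lean` grafted onto `RX1 … RX9`, **`runs_a2Sort`**), then one scan of the sorted
  words (`a2Scan`, **`runs_a2Scan`**, specified by the fold `scanRun`/`scanStep`): a giant step
  whose key equals the last baby-step key is a match and is handed to the recovery of Lemma 10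
  (`a2Recover`, **`runs_a2Recover`**: `u = i + jm + ⌈√(4abN)⌉`, the square test of `u² − 4abN`,
  the gcds of `(u ± √·)/2` with `N`; `recoverSpec`); an unmatched giant step joins the list of
  values for Step 4;
* Step 4 (`a2Six`, **`runs_a2Six`**): the unmatched values, padded with zeros to `2^e` values, are
  handed to Algorithm 1 of `StackAlgOne.lean` with the shift `c = C` and `k = |enc(2^e + m)| + 1`;
* the whole (`alg2`, **`runs_alg2`**): from registers `BLA = α`, `A2Y = m`, `A2R = r` the machine
  ends with `A2P = encOpt (a2Out N α m r)`, `A2Q = flagOpt (a2Out N α m r)` within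
  `alg2Cost N n α m r` steps, every other register it used restored; `a2Out` is the closed form of
  the outcome (the factor of Step 1, else of the recovery, else of Algorithm 1).

This file holds the utilities, Step 1, the two word lists and the sort (sections up to
`AlgTwoSortPass`); the scan, the recovery, Step 4 and the assembly `alg2` are in the sequel
`StackHarveySearchScan.lean` (the split is only for size).  The arithmetic meaning of `a2Out` (a
reported factor is a proper divisor; for `N = pq` in Lehman's range a factor IS reported) is proved
separately, from `Harvey2021Search.prop42_witness`.  All control is by flag-guarded fixed-count
loops; every theorem is proved, no named facts.

## References

* D. Harvey, *An exponent one-fifth algorithm for deterministic integer factorisation*,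
  Math. Comp. 90 (2021) 2937–2950, §4, Algorithm 2 and Prop. 4.2 (arXiv:2010.05450, Algorithm 2,
  Prop. 15); Lemma 3.1 (arXiv Lemma 10) for the recovery. [Harvey2021]
* M. Hittmeir, *A time-space tradeoff for Lehman's deterministic integer factorization method*,
  Math. Comp. 90 (2021) 1999–2010, arXiv:2006.16729 (the sort-and-match search). (Folklore
  material, fully proved here.)
* D. E. Knuth, *The Art of Computer Programming*, Vol. 3, §5.2.5 (LSD radix sort).
-/

namespace Literature.Computability.Complexity

open _root_.Computability SProg

namespace Com

variable {β : Type} [DecidableEq β] (h : HReg ↪ β)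


/-! ### Harvey's Algorithm 2 (the main search) on the machine: utilities

The integer square root of `StackIsqrt.lean` at a call site (its private bank grafted onto
`SQ1 … SQ5`, `X6` and the operand register), and the assembly of sortable words. -/

section AlgTwoUtil

/-- The bank assignment of the square-root routine for the operand register `S`. [folklore] -/
def sqMap (S : HReg) : SqReg → HReg
  | .dst => .SQ1 | .src => S | .u => .SQ2 | .p => .SQ3 | .c => .SQ4 | .sq => .SQ5 | .f => .X6

/-- The registers of the bank other than the operand. [folklore] -/
def sqBank : List HReg := [.SQ1, .SQ2, .SQ3, .SQ4, .SQ5, .X6]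

/-- `sqMap` is injective when the operand register is outside the bank. [folklore] -/
theorem sqMap_injective {S : HReg} (hS : S ∉ sqBank) : Function.Injective (sqMap S) := by
  intro a b hab
  simp only [sqBank, List.mem_cons, List.mem_nil_iff, or_false, not_or] at hS
  obtain ⟨h1, h2, h3, h4, h5, h6⟩ := hS
  cases a <;> cases b <;> simp only [sqMap] at hab <;> first | rfl | (exfalso; first
    | exact h1 hab.symm | exact h1 hab | exact h2 hab.symm | exact h2 hab | exact h3 hab.symm | exact h3 hab
    | exact h4 hab.symm | exact h4 hab | exact h5 hab.symm | exact h5 hab | exact h6 hab.symm | exact h6 hab | exact HReg.noConfusion hab)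

/-- `⌊√S⌋` into `SQ1` at the call site. [folklore] -/
def isqrtAt (S : HReg) : Com (EReg ⊕ β) := isqrtProg.map (Sum.map id (h ∘ sqMap S))

/-- **The square root at a call site**: `SQ1 := ⌊√x⌋` for the numeral `x` in `S`. [folklore] -/
theorem runs_isqrtAt {S : HReg} (hS : S ∉ sqBank) {x n : ℕ} (hxn : (encodeNat x).length ≤ n) (T : Regs β) (u : HSlots)
    (hx : hSt h T u (h S) = encodeNat x) (hsq1 : u.sq1 = []) (hsq2 : u.sq2 = []) (hsq3 : u.sq3 = []) (hsq4 : u.sq4 = []) (hsq5 : u.sq5 = []) (hx6 : u.x6 = []) :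
    Runs (isqrtAt h S) (base (hSt h T u)) (base (hSt h T { u with sq1 := encodeNat (Nat.sqrt x) })) (isqrtCost n) := by
  have hinj : Function.Injective (h ∘ sqMap S) := h.injective.comp (sqMap_injective hS)
  simp only [sqBank, List.mem_cons, List.mem_nil_iff, or_false, not_or] at hS
  obtain ⟨h1, h2, h3, h4, h5, h6⟩ := hS
  have hr := Runs.viaBank (g := h ∘ sqMap S) hinj (runs_isqrtProg (x := x) hxn [] (by simp)) (hSt h T u) (fun r => by
    cases r <;> simp [sqMap, SqReg.file, hx, hsq1, hsq2, hsq3, hsq4, hsq5, hx6])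
  have hupd : hSt h T { u with sq1 := encodeNat (Nat.sqrt x) } = Function.update (hSt h T u) (h .SQ1) (encodeNat (Nat.sqrt x)) :=
    (update_hSt_SQ1 h T u (encodeNat (Nat.sqrt x))).symm
  refine hr.of_eq ?_ le_rfl
  rw [hupd]
  congr 1
  funext r
  by_cases hr' : ∃ i, (h ∘ sqMap S) i = r
  · obtain ⟨i, rfl⟩ := hr'
    rw [graft_apply _ hinj]
    cases i with
    | dst => simp [sqMap, SqReg.file]
    | src =>
      simp only [Function.comp, sqMap, SqReg.file_src]
      rw [Function.update_of_ne (by intro he; exact h1 (h.injective he))]; exact hx.symm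
    | u => simp [sqMap, SqReg.file, hsq2]
    | p => simp [sqMap, SqReg.file, hsq3]
    | c => simp [sqMap, SqReg.file, hsq4]
    | sq => simp [sqMap, SqReg.file, hsq5]
    | f => simp [sqMap, SqReg.file, hx6]
  · have hne : ∀ i, (h ∘ sqMap S) i ≠ r := fun i hi => hr' ⟨i, hi⟩
    have : r ≠ h .SQ1 := fun hh => hne .dst (by simp [sqMap, hh])
    rw [graft_of_not _ _ _ hne, Function.update_of_ne this]

/-- Partial sums `f 0 + ⋯ + f (k−1)`. [folklore] -/
def lsum (f : ℕ → ℕ) : ℕ → ℕ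
  | 0 => 0
  | k + 1 => lsum f k + f k

/-- `lsum` is monotone in the length. [folklore] -/
theorem lsum_le_lsum (f : ℕ → ℕ) {j k : ℕ} (h : j ≤ k) : lsum f j ≤ lsum f k := by
  induction k with
  | zero => simp [Nat.le_zero.1 h]
  | succ k ih =>
    rcases Nat.lt_succ_iff_lt_or_eq.1 (Nat.lt_succ_iff.2 h) with hlt | rfl
    · exact (ih (by omega)).trans (by simp [lsum])
    · exact le_rfl

/-- Pointwise bound on `lsum`. [folklore] -/
theorem lsum_le_mul (f : ℕ → ℕ) (c : ℕ) {k : ℕ} (h : ∀ i < k, f i ≤ c) : lsum f k ≤ k * c := by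
  induction k with
  | zero => simp [lsum]
  | succ k ih => simp only [lsum]; have := ih (fun i hi => h i (by omega)); have := h k (by omega); rw [Nat.succ_mul]; omega

/-- **The counted-loop rule with round-dependent costs**: round `k + 1 → k` costs `f k`. [folklore] -/
theorem runs_countLoop_var {ι : Type} [DecidableEq ι] {U : ι} {body : Com ι} (P : ℕ → Regs ι → Prop) (f : ℕ → ℕ)
    (hbody : ∀ (k : ℕ) (R : Regs ι), P (k + 1) R → R U = List.replicate (k + 1) true →
      ∃ R', Runs body (Function.update R U (List.replicate k true)) R' (f k) ∧ R' U = List.replicate k true ∧ P k R') :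
    ∀ (k : ℕ) (R : Regs ι), P k R → R U = List.replicate k true →
      ∃ R', Runs (countLoop U body) R R' (lsum f k + 2 * k + 1) ∧ R' U = [] ∧ P 0 R'
  | 0, R, hP, hU => ⟨R, (Runs.loop_nil _ _ hU).of_eq rfl (by simp [lsum]), hU, hP⟩
  | k + 1, R, hP, hU => by
    obtain ⟨R₁, hb, hU₁, hP₁⟩ := hbody k R hP hU
    obtain ⟨R', hloop, hU', hP'⟩ := runs_countLoop_var P f hbody k R₁ hP₁ hU₁
    refine ⟨R', (Runs.loop_true (w := List.replicate k true) (by rw [hU, List.replicate_succ]) hb hloop).of_eq rfl ?_, hU', hP'⟩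
    simp only [lsum]; omega

end AlgTwoUtil

/-! ### Harvey's Algorithm 2 on the machine, pass by pass

Inputs: `BLA = α`, `A2Y = m`, `A2R = r` (numbers), ambient `MD = N`, `CINV`.  Derived in the
initialisation: `A2D = |enc N|` (the key width), `A2U = 1^{|enc N|}`, `A2AL = 4rm`,
`A2S = ⌊√N⌋ + 1`, `A2JJ = J* = ⌊A2S / 4rm⌋ + 1`, `A2C = α^{J* m}`, `A2AM = α^m`. -/

section AlgTwoInit

/-- The initialisation. [folklore] -/
def a2Init : Com (EReg ⊕ β) :=
  ((NS.ofList [.len (h .A2D) (h (.g (.f (.n (.v .MD))))) (h .X2), .toUnary (h .A2U) (h .A2D), .mul (h .X2) (h .A2R) (h .A2Y)] : NS β).com) ;;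
  (((NS.ofList [.add (h .X3) (h .X2) (h .X2), .add (h .A2AL) (h .X3) (h .X3), .clear (h .X2), .clear (h .X3)] : NS β).com) ;;
  ((isqrtAt h (.g (.f (.n (.v .MD))))) ;;
  (((NS.ofList [.succ (h .A2S) (h .SQ1), .clear (h .SQ1), .divMod (h .X2) (h .X3) (h .A2S) (h .A2AL), .succ (h .A2JJ) (h .X2), .clear (h .X2), .clear (h .X3)] : NS β).com) ;;
  ((NS.ofList [.mul (h .X2) (h .A2JJ) (h .A2Y), .powMod (h .A2C) (h .BLA) (h .X2) (h (.g (.f (.n (.v .MD))))), .clear (h .X2),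
      .powMod (h .A2AM) (h .BLA) (h .A2Y) (h (.g (.f (.n (.v .MD)))))] : NS β).com))))

/-- `J*`. [folklore] -/
def a2JStar (N m r : ℕ) : ℕ := (Nat.sqrt N + 1) / (4 * r * m) + 1

/-- The registers after the initialisation. [folklore] -/
def HSlots.a2InitRes (u : HSlots) (N α m r nb : ℕ) : HSlots :=
  { u with a2d := encodeNat nb, a2u := List.replicate nb true, a2al := encodeNat (4 * r * m), a2s := encodeNat (Nat.sqrt N + 1),
           a2jj := encodeNat (a2JStar N m r), a2c := encodeNat (α ^ (a2JStar N m r * m) % N), a2am := encodeNat (α ^ m % N) }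

/-- Cost of the initialisation. [folklore] -/
def a2InitCost (n : ℕ) : ℕ := 5114 * (n + 1) ^ 3 + isqrtCost n

/-- Size facts of the initialisation. [folklore] -/
theorem a2Init_sizes {N n m r : ℕ} (hN1 : 1 < N) (hn : 2 * (encodeNat N).length + 8 ≤ n) (hm1 : 1 ≤ m) (hmN : m ≤ N) (hr1 : 1 ≤ r) (hrN : r ≤ N) :
    (encodeNat (r * m)).length ≤ n ∧ (encodeNat (r * m + r * m)).length ≤ n ∧ (encodeNat (4 * r * m)).length ≤ n ∧
    Nat.sqrt N + 1 ≤ N ∧ a2JStar N m r ≤ N ∧ (encodeNat (a2JStar N m r * m)).length ≤ n := by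
  have hlN : (encodeNat N).length ≤ n := by omega
  have hrm0 : 0 < r * m := Nat.mul_pos (by omega) (by omega)
  have hbase := Brick.length_encodeNat_mono (Nat.mul_le_mul hrN hmN)
  have hNN := length_encodeNat_mul_le N N
  have hlrm : (encodeNat (r * m)).length ≤ n := by omega
  have e2 : r * m + r * m = 2 * (r * m) := by ring
  have e4 : 4 * r * m = 2 * (2 * (r * m)) := by ring
  have hd1 : (encodeNat (2 * (r * m))).length = (encodeNat (r * m)).length + 1 := by rw [encodeNat_two_mul _ hrm0]; rfl
  have hd2 : (encodeNat (2 * (2 * (r * m)))).length = (encodeNat (2 * (r * m))).length + 1 := by rw [encodeNat_two_mul _ (by omega)]; rfl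
  have hsq : Nat.sqrt N + 1 ≤ N := by have := Nat.sqrt_lt_self hN1; omega
  have hJ : a2JStar N m r ≤ N := by
    have h4 : 4 ≤ 4 * r * m := by nlinarith
    have : (Nat.sqrt N + 1) / (4 * r * m) ≤ (Nat.sqrt N + 1) / 4 := Nat.div_le_div_left h4 (by omega)
    have : (Nat.sqrt N + 1) / 4 < N := by apply Nat.div_lt_of_lt_mul; omega
    simp only [a2JStar]; omega
  have hJm := length_encodeNat_mul_le (a2JStar N m r) m
  have h1 := Brick.length_encodeNat_mono hJ; have h2 := Brick.length_encodeNat_mono hmN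
  refine ⟨hlrm, by rw [e2, hd1]; omega, by rw [e4, hd2, hd1]; omega, hsq, hJ, by omega⟩

/-- Initialisation, block 1. [folklore] -/
theorem runs_a2InitA1 {N n m r nb : ℕ} (hn : 2 * (encodeNat N).length + 8 ≤ n) (hnb : (encodeNat N).length = nb) (T : Regs β) (hI : DrvInv (rGH h) N T) (u : HSlots)
    (hmN : m ≤ N) (hrN : r ≤ N) (ha2y : u.a2y = encodeNat m) (ha2r : u.a2r = encodeNat r)
    (ha2d : u.a2d = []) (ha2u : u.a2u = []) (hx2 : u.x2 = []) :
    Runs ((NS.ofList [.len (h .A2D) (h (.g (.f (.n (.v .MD))))) (h .X2), .toUnary (h .A2U) (h .A2D), .mul (h .X2) (h .A2R) (h .A2Y)] : NS β).com) (base (hSt h T u))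
      (base (hSt h T { u with a2d := encodeNat nb, a2u := List.replicate nb true, x2 := encodeNat (r * m) })) (402 * (n + 1) ^ 3) := by
  obtain ⟨hMD, -, -, -, -, -, -, -, -, -, -, -, -, -, -, -, -, -⟩ := id hI
  have rdMD : ∀ u' : HSlots, hSt h T u' (h (.g (.f (.n (.v .MD))))) = encodeNat N := fun u' => by
    rw [hSt_gv h T u' (by decide) (by decide) (by decide) (by decide) (by decide) (by decide)]; exact hMD
  have hlN : (encodeNat N).length ≤ n := by omega
  have hlm : (encodeNat m).length ≤ n := (Brick.length_encodeNat_mono hmN).trans hlN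
  have hlr : (encodeNat r).length ≤ n := (Brick.length_encodeNat_mono hrN).trans hlN
  have hnbn : nb ≤ n := by omega
  have hlnb : (encodeNat nb).length ≤ n := (length_encodeNat_le_succ (le_two_pow_self nb)).trans (by omega)
  refine NS.runs_of_eq (N := n) _ _ ?_ ?_ (by simp)
  · simp (config := { decide := true }) only [NS.ofList, NS.ok, NOp.ok, NS.eval, NOp.eval, hSt_A2D, hSt_X2, hSt_A2U, hSt_A2R, hSt_A2Y,
      update_hSt_A2D, update_hSt_A2U, ha2d, hx2, ha2u, ha2r, ha2y, rdMD, hnb, bitsToNat_encodeNat, ne_eq, EmbeddingLike.apply_eq_iff_eq, List.length_nil, zero_le, and_self, hlnb,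
      hlr, hlm, hnbn, not_false_eq_true]
  · simp [hx2, ha2u, ha2r, ha2y, rdMD, hnb]

/-- Initialisation, block 2. [folklore] -/
theorem runs_a2InitA2 {N n m r : ℕ} (hN1 : 1 < N) (hn : 2 * (encodeNat N).length + 8 ≤ n) (T : Regs β) (u : HSlots)
    (hm1 : 1 ≤ m) (hmN : m ≤ N) (hr1 : 1 ≤ r) (hrN : r ≤ N) (hx2 : u.x2 = encodeNat (r * m)) (ha2al : u.a2al = []) (hx3 : u.x3 = []) :
    Runs ((NS.ofList [.add (h .X3) (h .X2) (h .X2), .add (h .A2AL) (h .X3) (h .X3), .clear (h .X2), .clear (h .X3)] : NS β).com) (base (hSt h T u))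
      (base (hSt h T { u with x2 := [], a2al := encodeNat (4 * r * m) })) (136 * (n + 1) ^ 3) := by
  obtain ⟨hlrm, hl2rm, hl4rm, -, -, -⟩ := a2Init_sizes hN1 hn hm1 hmN hr1 hrN
  have e4 : r * m + r * m + (r * m + r * m) = 4 * r * m := by ring
  refine NS.runs_of_eq (N := n) _ _ ?_ ?_ (by simp)
  · simp (config := { decide := true }) only [NS.ofList, NS.ok, NOp.ok, NS.eval, NOp.eval, hSt_X2, hSt_X3, hSt_A2AL, update_hSt_X2, update_hSt_X3, update_hSt_A2AL, hx2, hx3, ha2al,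
      bitsToNat_encodeNat, List.length_nil, zero_le, and_self, hlrm, hl2rm, e4]
  · simp [hx2, hx3, ha2al, e4]

/-- Initialisation, block 3. [folklore] -/
theorem runs_a2InitB1 {N n m r : ℕ} (hN1 : 1 < N) (hn : 2 * (encodeNat N).length + 8 ≤ n) (T : Regs β) (u : HSlots)
    (hm1 : 1 ≤ m) (hmN : m ≤ N) (hr1 : 1 ≤ r) (hrN : r ≤ N)
    (ha2al : u.a2al = encodeNat (4 * r * m)) (hsq1 : u.sq1 = encodeNat (Nat.sqrt N)) (ha2s : u.a2s = []) (ha2jj : u.a2jj = []) (hx2 : u.x2 = []) (hx3 : u.x3 = []) :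
    Runs ((NS.ofList [.succ (h .A2S) (h .SQ1), .clear (h .SQ1), .divMod (h .X2) (h .X3) (h .A2S) (h .A2AL), .succ (h .A2JJ) (h .X2), .clear (h .X2), .clear (h .X3)] : NS β).com)
      (base (hSt h T u)) (base (hSt h T { u with sq1 := [], a2s := encodeNat (Nat.sqrt N + 1), a2jj := encodeNat (a2JStar N m r) })) (503 * (n + 1) ^ 3) := by
  obtain ⟨-, -, hl4rm, hsq, hJ, -⟩ := a2Init_sizes hN1 hn hm1 hmN hr1 hrN
  have hlN : (encodeNat N).length ≤ n := by omega
  have h4 : 0 < 4 * r * m := by nlinarith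
  have hlS : (encodeNat (Nat.sqrt N + 1)).length ≤ n := (Brick.length_encodeNat_mono hsq).trans hlN
  have hlS0 : (encodeNat (Nat.sqrt N)).length ≤ n := (Brick.length_encodeNat_mono (by omega : Nat.sqrt N ≤ N)).trans hlN
  have hlJ : (encodeNat ((Nat.sqrt N + 1) / (4 * r * m) + 1)).length ≤ n := (Brick.length_encodeNat_mono (by simpa [a2JStar] using hJ)).trans hlN
  have hlJ0 : (encodeNat ((Nat.sqrt N + 1) / (4 * r * m))).length ≤ n := (Brick.length_encodeNat_mono (by simp only [a2JStar] at hJ; omega)).trans hlN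
  have hlmod : (encodeNat ((Nat.sqrt N + 1) % (4 * r * m))).length ≤ n := (Brick.length_encodeNat_mono ((Nat.mod_le _ _).trans hsq)).trans hlN
  refine NS.runs_of_eq (N := n) _ _ ?_ ?_ (by simp)
  · simp (config := { decide := true }) only [NS.ofList, NS.ok, NOp.ok, NS.eval, NOp.eval, hSt_A2S, hSt_SQ1, hSt_X2, hSt_X3, hSt_A2AL, hSt_A2JJ,
      update_hSt_A2S, update_hSt_SQ1, update_hSt_X2, update_hSt_X3, update_hSt_A2JJ, ha2s, hx2, hx3, ha2jj, hsq1, ha2al,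
      bitsToNat_encodeNat, ne_eq, EmbeddingLike.apply_eq_iff_eq, List.length_nil, zero_le, and_self, hlS, hlS0, hl4rm, hlJ0, hlmod, h4, not_false_eq_true]
  · simp [hx2, hx3, ha2jj, hsq1, ha2al, a2JStar]

/-- Initialisation, block 4. [folklore] -/
theorem runs_a2InitB2 {N n α m r : ℕ} (hN1 : 1 < N) (hn : 2 * (encodeNat N).length + 8 ≤ n) (T : Regs β) (hI : DrvInv (rGH h) N T) (u : HSlots)
    (hαN : α < N) (hm1 : 1 ≤ m) (hmN : m ≤ N) (hr1 : 1 ≤ r) (hrN : r ≤ N)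
    (hbla : u.bla = encodeNat α) (ha2y : u.a2y = encodeNat m) (ha2jj : u.a2jj = encodeNat (a2JStar N m r)) (ha2c : u.a2c = []) (ha2am : u.a2am = []) (hx2 : u.x2 = []) :
    Runs ((NS.ofList [.mul (h .X2) (h .A2JJ) (h .A2Y), .powMod (h .A2C) (h .BLA) (h .X2) (h (.g (.f (.n (.v .MD))))), .clear (h .X2),
      .powMod (h .A2AM) (h .BLA) (h .A2Y) (h (.g (.f (.n (.v .MD)))))] : NS β).com) (base (hSt h T u))
      (base (hSt h T { u with a2c := encodeNat (α ^ (a2JStar N m r * m) % N), a2am := encodeNat (α ^ m % N) })) (4073 * (n + 1) ^ 3) := by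
  have hN0 : 0 < N := by omega
  obtain ⟨hMD, -, -, -, -, -, -, -, -, -, -, -, -, -, -, -, -, -⟩ := id hI
  have rdMD : ∀ u' : HSlots, hSt h T u' (h (.g (.f (.n (.v .MD))))) = encodeNat N := fun u' => by
    rw [hSt_gv h T u' (by decide) (by decide) (by decide) (by decide) (by decide) (by decide)]; exact hMD
  obtain ⟨-, -, -, -, hJ, hlJm⟩ := a2Init_sizes hN1 hn hm1 hmN hr1 hrN
  have hlN : (encodeNat N).length ≤ n := by omega
  have hlα : (encodeNat α).length ≤ n := (Brick.length_encodeNat_mono hαN.le).trans hlN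
  have hlm : (encodeNat m).length ≤ n := (Brick.length_encodeNat_mono hmN).trans hlN
  have hlJ : (encodeNat (a2JStar N m r)).length ≤ n := (Brick.length_encodeNat_mono hJ).trans hlN
  have hlC : (encodeNat (α ^ (a2JStar N m r * m) % N)).length ≤ n := (Brick.length_encodeNat_mono (Nat.mod_lt _ hN0).le).trans hlN
  refine NS.runs_of_eq (N := n) _ _ ?_ ?_ (by simp)
  · simp (config := { decide := true }) only [NS.ofList, NS.ok, NOp.ok, NS.eval, NOp.eval, hSt_X2, hSt_A2JJ, hSt_A2Y, hSt_A2C, hSt_BLA, hSt_A2AM,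
      update_hSt_X2, update_hSt_A2C, hx2, ha2jj, ha2y, ha2c, hbla, rdMD, ha2am, bitsToNat_encodeNat, ne_eq, EmbeddingLike.apply_eq_iff_eq, List.length_nil, zero_le, and_self,
      hlm, hlα, hlN, hlJ, hlJm, hN1, not_false_eq_true]
  · simp [hx2, ha2jj, ha2y, ha2c, hbla, rdMD, ha2am]

/-- **Initialisation.** [folklore] -/
theorem runs_a2Init {N n α m r : ℕ} (hN1 : 1 < N) (hn : 2 * (encodeNat N).length + 8 ≤ n) (T : Regs β) (hI : DrvInv (rGH h) N T) (u : HSlots)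
    (hαN : α < N) (hm1 : 1 ≤ m) (hmN : m ≤ N) (hr1 : 1 ≤ r) (hrN : r ≤ N)
    (hbla : u.bla = encodeNat α) (ha2y : u.a2y = encodeNat m) (ha2r : u.a2r = encodeNat r)
    (ha2d : u.a2d = []) (ha2u : u.a2u = []) (ha2al : u.a2al = []) (ha2s : u.a2s = []) (ha2jj : u.a2jj = []) (ha2c : u.a2c = []) (ha2am : u.a2am = [])
    (hx2 : u.x2 = []) (hx3 : u.x3 = []) (hx6 : u.x6 = []) (hsq1 : u.sq1 = []) (hsq2 : u.sq2 = []) (hsq3 : u.sq3 = []) (hsq4 : u.sq4 = []) (hsq5 : u.sq5 = []) :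
    Runs (a2Init h) (base (hSt h T u)) (base (hSt h T (u.a2InitRes N α m r (encodeNat N).length))) (a2InitCost n) := by
  obtain ⟨hMD, -, -, -, -, -, -, -, -, -, -, -, -, -, -, -, -, -⟩ := id hI
  have rdMD : ∀ u' : HSlots, hSt h T u' (h (.g (.f (.n (.v .MD))))) = encodeNat N := fun u' => by
    rw [hSt_gv h T u' (by decide) (by decide) (by decide) (by decide) (by decide) (by decide)]; exact hMD
  have hlN : (encodeNat N).length ≤ n := by omega
  generalize hnb : (encodeNat N).length = nb
  have h1 := runs_a2InitA1 h hn hnb T hI u hmN hrN ha2y ha2r ha2d ha2u hx2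
  let u1 : HSlots := { u with a2d := encodeNat nb, a2u := List.replicate nb true, x2 := encodeNat (r * m) }
  have h2 := runs_a2InitA2 h (N := N) hN1 hn T u1 hm1 hmN hr1 hrN (by simp [u1]) (by simp [u1, ha2al]) (by simp [u1, hx3])
  let u2 : HSlots := { u1 with x2 := [], a2al := encodeNat (4 * r * m) }
  have h3 : Runs (isqrtAt h (.g (.f (.n (.v .MD))))) (base (hSt h T u2)) (base (hSt h T { u2 with sq1 := encodeNat (Nat.sqrt N) })) (isqrtCost n) :=
    runs_isqrtAt h (S := .g (.f (.n (.v .MD)))) (by decide) hlN T u2 (rdMD u2) (by simp [u2, u1, hsq1]) (by simp [u2, u1, hsq2]) (by simp [u2, u1, hsq3]) (by simp [u2, u1, hsq4])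
      (by simp [u2, u1, hsq5]) (by simp [u2, u1, hx6])
  let u3 : HSlots := { u2 with sq1 := encodeNat (Nat.sqrt N) }
  have h4 := runs_a2InitB1 h (N := N) hN1 hn T u3 hm1 hmN hr1 hrN (by simp [u3, u2]) (by simp [u3]) (by simp [u3, u2, u1, ha2s]) (by simp [u3, u2, u1, ha2jj]) (by simp [u3, u2])
    (by simp [u3, u2, u1, hx3])
  let u4 : HSlots := { u3 with sq1 := [], a2s := encodeNat (Nat.sqrt N + 1), a2jj := encodeNat (a2JStar N m r) }
  have h5 := runs_a2InitB2 h hN1 hn T hI u4 hαN hm1 hmN hr1 hrN (by simp [u4, u3, u2, u1, hbla]) (by simp [u4, u3, u2, u1, ha2y]) (by simp [u4]) (by simp [u4, u3, u2, u1, ha2c])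
    (by simp [u4, u3, u2, u1, ha2am]) (by simp [u4, u3, u2])
  refine (h1.seq (h2.seq (h3.seq (h4.seq h5)))).of_eq ?_ (by simp only [a2InitCost]; omega)
  simp [u4, u3, u2, u1, HSlots.a2InitRes, hsq1, hx2]

end AlgTwoInit

section AlgTwoPow

/-! #### Step 1: the scan of `gcd(α^i − 1, N)`, `1 ≤ i < m`

The residue `(α^i − 1) mod N` is computed by `sfPowSub` of the base search (`X1 = 1`, exponent on
`X2`, result on `X5`), its gcd with `N` by `nGcd`; a gcd `≠ 1` is recorded on `A2P` with the flag
`A2Q`, which guards the remaining rounds. -/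

/-- The casework on the gcd in `X3`: `= 1`: discard; else record it on `A2P` and raise `A2Q`. [folklore] -/
def a2PowCase : NS β :=
  NS.seq (NS.ofList [.clear (h .X5), .eq (h .FL1) (h .X3) (h .X1) (h .X4)])
    (NS.ite (h .FL1) (NS.ofList [.clear (h .X3)]) (NS.ofList [.move (h .X3) (h .A2P), .const (h .A2Q) [true]]))

/-- One exponent of the scan, guarded by `A2Q`; the exponent `X2` is then incremented. [folklore] -/
def a2PowInner : Com (EReg ⊕ β) :=
  (sfPowSub h .X2).com ;; (nGcd (h .X3) (h .X5) (h (.g (.f (.n (.v .MD))))) ;; ((a2PowCase h).com ;;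
    ((NS.ofList [.succ (h .X4) (h .X2), .clear (h .X2), .move (h .X4) (h .X2)] : NS β).com)))

/-- One exponent of the scan, guarded by `A2Q`. [folklore] -/
def a2PowBody : Com (EReg ⊕ β) := whenNot h .A2Q (a2PowInner h)

/-- The scan: `X1 := 1`, `X2 := 1`, `m − 1` guarded rounds, clean-up. [folklore] -/
def a2Pow : Com (EReg ⊕ β) :=
  ((NS.ofList [.const (h .X1) (encodeNat 1), .const (h .X2) (encodeNat 1), .sub (h .X3) (h .A2Y) (h .X1)] : NS β).com) ;;
  (nToUnary (h .U1) (h .X3) ;; (((NS.op (.clear (h .X3))) : NS β).com ;; (countLoop (Sum.inr (h .U1)) (a2PowBody h) ;;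
  ((NS.ofList [.clear (h .X1), .clear (h .X2)] : NS β).com))))

/-- The hit predicate of the scan: `gcd(α^{i+1} − 1, N) ≠ 1`. [folklore] -/
def powHit (N α : ℕ) (i : ℕ) : Bool := decide (powGcd N α (i + 1) ≠ 1)

/-- Searching state: `i` rounds to go, `j` exponents done (`X2 = j + 1`). [folklore] -/
def HSlots.srchP (u : HSlots) (i j : ℕ) : HSlots := { u with u1 := List.replicate i true, x2 := encodeNat (j + 1) }

/-- Found state: hit at index `i₀` (exponent `i₀ + 1`). [folklore] -/
def HSlots.fndP (u : HSlots) (N α i i₀ : ℕ) : HSlots :=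
  { u with u1 := List.replicate i true, x2 := encodeNat (i₀ + 2), a2p := encodeNat (powGcd N α (i₀ + 1)), a2q := [true] }

/-- The state after one more searching round. [folklore] -/
def HSlots.powStep (u : HSlots) (N α i j : ℕ) : HSlots := if powHit N α j then u.fndP N α i j else u.srchP i (j + 1)

/-- The state of the scan with `i` rounds to go after `j` exponents. [folklore] -/
def HSlots.powAt (u : HSlots) (N α i j : ℕ) : HSlots :=
  match firstHit (powHit N α) j with
  | none => u.srchP i j
  | some i₀ => u.fndP N α i i₀

/-- One searching round. [folklore] -/
theorem runs_a2PowBody_srch {N n α i j : ℕ} (hN1 : 1 < N) (hn : 2 * (encodeNat N).length + 8 ≤ n) (T : Regs β) (hI : DrvInv (rGH h) N T) (u : HSlots)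
    (hαN : α < N) (hjN : j + 2 ≤ N) (hbla : u.bla = encodeNat α) (hx1 : u.x1 = encodeNat 1) (ha2p : u.a2p = []) (ha2q : u.a2q = [])
    (hx3 : u.x3 = []) (hx4 : u.x4 = []) (hx5 : u.x5 = []) (hx6 : u.x6 = []) (hfl1 : u.fl1 = []) :
    Runs (a2PowBody h) (base (hSt h T { u.srchP (i + 1) j with u1 := List.replicate i true })) (base (hSt h T (u.powStep N α i j))) (3615 * (n + 1) ^ 3 + 2) := by
  have hN0 : 0 < N := by omega
  obtain ⟨hMD, -, -, -, -, -, -, -, -, -, -, -, -, -, -, -, -, -⟩ := id hI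
  have rdMD : ∀ u' : HSlots, hSt h T u' (h (.g (.f (.n (.v .MD))))) = encodeNat N := fun u' => by
    rw [hSt_gv h T u' (by decide) (by decide) (by decide) (by decide) (by decide) (by decide)]; exact hMD
  set c := (n + 1) ^ 3 with hc3
  have hc1 : n + 1 ≤ c := by
    rw [hc3]; calc n + 1 = (n + 1) ^ 1 := (pow_one _).symm
      _ ≤ (n + 1) ^ 3 := Nat.pow_le_pow_right (by omega) (by omega)
  have hlN : (encodeNat N).length ≤ n := by omega
  have hlα : (encodeNat α).length ≤ n := (Brick.length_encodeNat_mono hαN.le).trans hlN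
  have hl2N : ∀ x, x ≤ 2 * N → (encodeNat x).length ≤ n := fun x hx =>
    (Brick.length_encodeNat_mono hx).trans (by rw [encodeNat_two_mul _ hN0]; simp only [List.length_cons]; omega)
  have e1 : encodeNat 1 = [true] := by simpa using encodeNat_two_pow 0
  have hl1n : (encodeNat 1).length ≤ n := by rw [e1]; simp only [List.length_cons, List.length_nil]; omega
  have hlj1 : (encodeNat (j + 1)).length ≤ n := hl2N _ (by omega)
  have hlj2 : (encodeNat (j + 2)).length ≤ n := hl2N _ (by omega)
  set x := α ^ (j + 1) % N with hx0
  have hxN : x < N := Nat.mod_lt _ hN0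
  have hlx : (encodeNat x).length ≤ n := (Brick.length_encodeNat_mono hxN.le).trans hlN
  have hl3 : (encodeNat (x + N)).length ≤ n := hl2N _ (by omega)
  have hl4 : (encodeNat (x + N - 1)).length ≤ n := hl2N _ (by omega)
  have hl5 : (encodeNat ((x + N - 1) / N)).length ≤ n := hl2N _ ((Nat.div_le_self _ _).trans (by omega))
  set r := (x + N - 1) % N with hr0
  have hlr : (encodeNat r).length ≤ n := (Brick.length_encodeNat_mono (Nat.mod_lt _ hN0).le).trans hlN
  have hg0 : powGcd N α (j + 1) = Nat.gcd r N := by rw [powGcd, hr0, hx0]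
  have hlg : (encodeNat (Nat.gcd r N)).length ≤ n := (Brick.length_encodeNat_mono (Nat.gcd_le_right _ hN0)).trans hlN
  have hone : 1 ≤ x + N := by omega
  let v : HSlots := { u with u1 := List.replicate i true, x2 := encodeNat (j + 1) }
  have hv : ({ u.srchP (i + 1) j with u1 := List.replicate i true } : HSlots) = v := by simp [HSlots.srchP, v]
  rw [hv]
  let v1 : HSlots := { v with x5 := encodeNat r }
  have h1 : Runs (sfPowSub h .X2).com (base (hSt h T v)) (base (hSt h T v1)) (2398 * c) := by
    refine NS.runs_of_eq (N := n) _ _ ?_ ?_ (by simp [hc3, sfPowSub])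
    · simp (config := { decide := true }) only [sfPowSub, NS.ofList, NS.ok, NOp.ok, NS.eval, NOp.eval, hSt_X1, hSt_X3, hSt_X5, hSt_X6, hSt_BLA, hSt_X2,
        update_hSt_X3, update_hSt_X5, update_hSt_X6, v, hx1, hx3, hx5, hx6, hbla, rdMD, bitsToNat_encodeNat, ne_eq, EmbeddingLike.apply_eq_iff_eq,
        List.length_nil, zero_le, and_self, hlα, hlj1, hlN, hN1, hN0, hlx, hl3, hl4, hl5, hl1n, hone, ← hx0, not_false_eq_true]
    · simp [sfPowSub, v, v1, hx1, hx3, hx5, hx6, hbla, rdMD, ← hx0, ← hr0]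
  have h2 : Runs (nGcd (h .X3) (h .X5) (h (.g (.f (.n (.v .MD)))))) (base (hSt h T v1)) (base (hSt h T { v1 with x3 := encodeNat (Nat.gcd r N) })) (1000 * c) := by
    have g1 := runs_nGcd (h .X3) (h .X5) (h (.g (.f (.n (.v .MD))))) (hSt h T v1) (x := r) (y := N) (n := n) (by simp [v1]) (rdMD v1) hlr hlN (by simp [v1, v, hx3])
    refine g1.of_eq ?_ (by simp [hc3])
    rw [update_hSt_X3]
  let v3 : HSlots := { v with a2p := if Nat.gcd r N = 1 then v.a2p else encodeNat (Nat.gcd r N), a2q := if Nat.gcd r N = 1 then v.a2q else [true] }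
  have h3 : Runs (a2PowCase h).com (base (hSt h T { v1 with x3 := encodeNat (Nat.gcd r N) })) (base (hSt h T v3)) (134 * c) := by
    by_cases hg1 : Nat.gcd r N = 1
    · refine NS.runs_of_eq (N := n) _ _ ?_ ?_ (by simp [hc3, a2PowCase])
      · simp (config := { decide := true }) only [a2PowCase, NS.ofList, NS.ok, NOp.ok, NS.eval, NOp.eval, hSt_X1, hSt_X3, hSt_X4, hSt_X5, hSt_FL1, update_hSt_X5, update_hSt_FL1,
          v1, v, hx1, hx4, hfl1, bitsToNat_encodeNat, hg1, ne_eq, EmbeddingLike.apply_eq_iff_eq, and_self, hl1n, hlr, not_false_eq_true, decide_true, flag_true, true_and,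
          true_or]
      · simp [a2PowCase, v1, v, v3, hx1, hx4, hx5, hfl1, hg1, hx3]
    · refine NS.runs_of_eq (N := n) _ _ ?_ ?_ (by simp [hc3, a2PowCase])
      · simp (config := { decide := true }) only [a2PowCase, NS.ofList, NS.ok, NOp.ok, NS.eval, NOp.eval, hSt_X1, hSt_X3, hSt_X4, hSt_X5, hSt_FL1, hSt_A2P, hSt_A2Q,
          update_hSt_X5, update_hSt_FL1, update_hSt_X3, update_hSt_A2P, v1, v, hx1, hx4, hfl1, ha2p, ha2q, bitsToNat_encodeNat, hg1, ne_eq, EmbeddingLike.apply_eq_iff_eq,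
          and_self, hl1n, hlr, hlg, not_false_eq_true, decide_false, flag_false, true_and, and_true, List.length_nil, List.length_cons, zero_le]
        right; omega
      · simp [a2PowCase, v1, v, v3, hx1, hx4, hx5, hfl1, hg1, hx3, ha2p, ha2q]
  have h4 : Runs ((NS.ofList [.succ (h .X4) (h .X2), .clear (h .X2), .move (h .X4) (h .X2)] : NS β).com) (base (hSt h T v3)) (base (hSt h T { v3 with x2 := encodeNat (j + 2) })) (83 * c) := by
    refine NS.runs_of_eq (N := n) _ _ ?_ ?_ (by simp [hc3])
    · simp (config := { decide := true }) only [NS.ofList, NS.ok, NOp.ok, NS.eval, NOp.eval, hSt_X4, hSt_X2, update_hSt_X4, update_hSt_X2, v3, v, hx4, bitsToNat_encodeNat, ne_eq,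
        EmbeddingLike.apply_eq_iff_eq, and_self, hlj1, hlj2, not_false_eq_true, List.length_nil, zero_le]
    · simp [v3, v, hx4]
  have hs : hSt h T v (h .A2Q) = [] := by simp [v, ha2q]
  refine (runs_whenNot_nil h (hSt h T v) hs (h1.seq (h2.seq (h3.seq h4)))).of_eq ?_ (by omega)
  by_cases hg1 : Nat.gcd r N = 1
  · have hp : powHit N α j = false := by simp [powHit, hg0, hg1]
    simp [HSlots.powStep, hp, HSlots.srchP, v3, v, hg1]
  · have hp : powHit N α j = true := by simp [powHit, hg0, hg1]
    simp [HSlots.powStep, hp, HSlots.fndP, v3, v, hg1, hg0]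

/-- The result of the scan. [folklore] -/
def HSlots.powRes (u : HSlots) (N α m : ℕ) : HSlots :=
  match firstHit (powHit N α) (m - 1) with
  | none => { u with x1 := [], x2 := [], u1 := [] }
  | some i₀ => { u with x1 := [], x2 := [], u1 := [], a2p := encodeNat (powGcd N α (i₀ + 1)), a2q := [true] }

/-- `powAt` steps. [folklore] -/
theorem HSlots.powAt_succ (u : HSlots) (N α i j : ℕ) :
    u.powAt N α i (j + 1) = (match firstHit (powHit N α) j with | some i₀ => u.fndP N α i i₀ | none => u.powStep N α i j) := by
  unfold HSlots.powAt HSlots.powStep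
  cases hf : firstHit (powHit N α) j with
  | some i₀ => rw [firstHit_succ_of_some hf]
  | none =>
    rw [firstHit_succ_of_none hf]
    by_cases hp : powHit N α j = true
    · simp [hp]
    · simp [hp]

/-- Cost of the scan. [folklore] -/
def a2PowCost (n m : ℕ) : ℕ := 88 * (n + 1) ^ 3 + ((encodeNat (m - 1)).length * (16 * (m - 1) + 21) + 5) + ((m - 1) * (3615 * (n + 1) ^ 3 + 2 + 2) + 1)

/-- **Step 1 of Algorithm 2**: the scan of `gcd(α^i − 1, N)`, `1 ≤ i ≤ m − 1`. [folklore] -/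
theorem runs_a2Pow {N n α m : ℕ} (hN1 : 1 < N) (hn : 2 * (encodeNat N).length + 8 ≤ n) (T : Regs β) (hI : DrvInv (rGH h) N T) (u : HSlots)
    (hαN : α < N) (hm1 : 1 ≤ m) (hmN : m ≤ N) (hbla : u.bla = encodeNat α) (ha2y : u.a2y = encodeNat m) (hx1 : u.x1 = []) (hx2 : u.x2 = []) (ha2p : u.a2p = []) (ha2q : u.a2q = [])
    (hx3 : u.x3 = []) (hx4 : u.x4 = []) (hx5 : u.x5 = []) (hx6 : u.x6 = []) (hfl1 : u.fl1 = []) (hu1 : u.u1 = []) :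
    Runs (a2Pow h) (base (hSt h T u)) (base (hSt h T (u.powRes N α m))) (a2PowCost n m) := by
  have hN0 : 0 < N := by omega
  set c := (n + 1) ^ 3 with hc3
  have hc1 : n + 1 ≤ c := by
    rw [hc3]; calc n + 1 = (n + 1) ^ 1 := (pow_one _).symm
      _ ≤ (n + 1) ^ 3 := Nat.pow_le_pow_right (by omega) (by omega)
  have hlN : (encodeNat N).length ≤ n := by omega
  have e1 : encodeNat 1 = [true] := by simpa using encodeNat_two_pow 0
  have hl1n : (encodeNat 1).length ≤ n := by rw [e1]; simp only [List.length_cons, List.length_nil]; omega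
  have hlm : (encodeNat m).length ≤ n := (Brick.length_encodeNat_mono hmN).trans hlN
  have hlm1 : (encodeNat (m - 1)).length ≤ n := (Brick.length_encodeNat_mono (Nat.sub_le _ _)).trans hlm
  let u0 : HSlots := { u with x1 := encodeNat 1, x2 := encodeNat 1, x3 := encodeNat (m - 1) }
  have h0 : Runs ((NS.ofList [.const (h .X1) (encodeNat 1), .const (h .X2) (encodeNat 1), .sub (h .X3) (h .A2Y) (h .X1)] : NS β).com) (base (hSt h T u)) (base (hSt h T u0)) (79 * c) := by
    refine NS.runs_of_eq (N := n) _ _ ?_ (by simp [u0, hx2, hx3, ha2y]) (by simp [hc3])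
    simp (config := { decide := true }) only [NS.ofList, NS.ok, NOp.ok, NS.eval, NOp.eval, hSt_X1, hSt_X2, hSt_X3, hSt_A2Y, update_hSt_X1, update_hSt_X2, hx1, hx2, hx3, ha2y,
      bitsToNat_encodeNat, List.length_nil, zero_le, and_self, hl1n, hlm, true_and, and_true]
    omega
  let u' : HSlots := { u with x1 := encodeNat 1 }
  have hstart : u'.powAt N α (m - 1) 0 = { u0 with x3 := [], u1 := List.replicate (m - 1) true } := by
    simp [HSlots.powAt, firstHit, HSlots.srchP, u', u0, hx3]
  have h1 : Runs (nToUnary (h .U1) (h .X3)) (base (hSt h T u0)) (base (hSt h T { u0 with u1 := List.replicate (m - 1) true })) ((encodeNat (m - 1)).length * (16 * (m - 1) + 21) + 5) := by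
    refine (runs_nToUnary (h .U1) (h .X3) (hSt h T u0) (by simp [u0, hu1])).of_eq ?_ ?_
    · simp [u0]
    · simp only [hSt_X3, u0, bitsToNat_encodeNat]; exact le_rfl
  have h2 : Runs ((NS.op (.clear (h .X3)) : NS β).com) (base (hSt h T { u0 with u1 := List.replicate (m - 1) true })) (base (hSt h T (u'.powAt N α (m - 1) 0))) (3 * c) := by
    rw [hstart]
    refine NS.runs_of_eq (N := n) _ _ (by simp only [NS.ok, NOp.ok, hSt_X3, u0]; exact hlm1) (by simp [u0]) (by simp [hc3])
  have hL := runs_countLoop (U := (Sum.inr (h .U1) : EReg ⊕ β)) (body := a2PowBody h) (fun i R => i ≤ m - 1 ∧ R = base (hSt h T (u'.powAt N α i (m - 1 - i)))) (3615 * c + 2)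
    (by
      rintro i R ⟨hi, rfl⟩ -
      have hj : m - 1 - i = (m - 1 - (i + 1)) + 1 := by omega
      have hjN : m - 1 - (i + 1) + 2 ≤ N := by omega
      rw [hj, HSlots.powAt_succ]
      cases hf : firstHit (powHit N α) (m - 1 - (i + 1)) with
      | some i₀ =>
        have hcur : u'.powAt N α (i + 1) (m - 1 - (i + 1)) = u'.fndP N α (i + 1) i₀ := by simp [HSlots.powAt, hf]
        rw [hcur]
        have hupd : Function.update (base (hSt h T (u'.fndP N α (i + 1) i₀))) (Sum.inr (h .U1)) (List.replicate i true) = base (hSt h T (u'.fndP N α i i₀)) := by simp [HSlots.fndP]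
        rw [hupd]
        exact ⟨_, (runs_whenNot_true h _ _ (by simp [HSlots.fndP, u'])).mono (by omega), by simp [HSlots.fndP], by omega, rfl⟩
      | none =>
        have hcur : u'.powAt N α (i + 1) (m - 1 - (i + 1)) = u'.srchP (i + 1) (m - 1 - (i + 1)) := by simp [HSlots.powAt, hf]
        rw [hcur]
        have hupd : Function.update (base (hSt h T (u'.srchP (i + 1) (m - 1 - (i + 1))))) (Sum.inr (h .U1)) (List.replicate i true) =
            base (hSt h T { u'.srchP (i + 1) (m - 1 - (i + 1)) with u1 := List.replicate i true }) := by simp [HSlots.srchP]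
        rw [hupd]
        refine ⟨_, runs_a2PowBody_srch h hN1 hn T hI u' hαN hjN (by simp [u', hbla]) (by simp [u']) (by simp [u', ha2p]) (by simp [u', ha2q]) (by simp [u', hx3])
          (by simp [u', hx4]) (by simp [u', hx5]) (by simp [u', hx6]) (by simp [u', hfl1]), ?_, by omega, rfl⟩
        simp only [HSlots.powStep]; split_ifs <;> simp [HSlots.fndP, HSlots.srchP])
    (m - 1) (base (hSt h T (u'.powAt N α (m - 1) 0))) ⟨le_rfl, by simp⟩ (by rw [hstart]; simp [u0])
  obtain ⟨R', hR, -, -, rfl⟩ := hL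
  simp only [Nat.sub_zero] at hR
  have h3 : Runs ((NS.ofList [.clear (h .X1), .clear (h .X2)] : NS β).com) (base (hSt h T (u'.powAt N α 0 (m - 1)))) (base (hSt h T (u.powRes N α m))) (6 * c) := by
    have hl2N : ∀ x, x ≤ 2 * N → (encodeNat x).length ≤ n := fun x hx =>
      (Brick.length_encodeNat_mono hx).trans (by rw [encodeNat_two_mul _ hN0]; simp only [List.length_cons]; omega)
    rcases firstHit_spec (powHit N α) (m - 1) with ⟨hf, -⟩ | ⟨i₀, hf, hi₀, -, -⟩
    · have e0 : u'.powAt N α 0 (m - 1) = u'.srchP 0 (m - 1) := by simp [HSlots.powAt, hf]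
      have e2 : u.powRes N α m = { u with x1 := [], x2 := [], u1 := [] } := by simp [HSlots.powRes, hf]
      rw [e0, e2]
      refine NS.runs_of_eq (N := n) _ _ ?_ (by simp [HSlots.srchP, u']) (by simp [hc3])
      simp only [NS.ofList, NS.ok, NOp.ok, NS.eval, NOp.eval, hSt_X1, hSt_X2, update_hSt_X1, HSlots.srchP, u']
      exact ⟨hl1n, hl2N _ (by omega), trivial⟩
    · have e0 : u'.powAt N α 0 (m - 1) = u'.fndP N α 0 i₀ := by simp [HSlots.powAt, hf]
      have e2 : u.powRes N α m = { u with x1 := [], x2 := [], u1 := [], a2p := encodeNat (powGcd N α (i₀ + 1)), a2q := [true] } := by simp [HSlots.powRes, hf]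
      rw [e0, e2]
      refine NS.runs_of_eq (N := n) _ _ ?_ (by simp [HSlots.fndP, u']) (by simp [hc3])
      simp only [NS.ofList, NS.ok, NOp.ok, NS.eval, NOp.eval, hSt_X1, hSt_X2, update_hSt_X1, HSlots.fndP, u']
      exact ⟨hl1n, hl2N _ (by omega), trivial⟩
  refine (h0.seq (h1.seq (h2.seq (hR.seq h3)))).of_eq rfl ?_
  simp only [a2PowCost, ← hc3]; omega

end AlgTwoPow

section AlgTwoEmit

/-! #### Sortable words

A word is `enc v ++ 0^{nb − |enc v|} ++ tag :: payload`: the value zero-padded to the key width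
`nb = |enc N|` (so that `lowBits nb` of the word is `v`), a tag bit (`false` = baby step,
`true` = giant step) and a payload. -/

/-- The sortable word of a value, a tag and a payload. [folklore] -/
def mkWord (nb v : ℕ) (tag : Bool) (pl : List Bool) : List Bool := encodeNat v ++ List.replicate (nb - (encodeNat v).length) false ++ tag :: pl

/-- The key of a word is its value. [folklore] -/
theorem lowBits_mkWord {nb v : ℕ} (hv : (encodeNat v).length ≤ nb) (tag : Bool) (pl : List Bool) : lowBits nb (mkWord nb v tag pl) = v := by
  have hlen : (encodeNat v ++ List.replicate (nb - (encodeNat v).length) false).length = nb := by simp; omega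
  rw [lowBits, mkWord, List.take_left' hlen, bitsToNat_append, bitsToNat_replicate_false, mul_zero, add_zero, bitsToNat_encodeNat]

/-- Building the word of the value on `A2T` (kept), the payload on `X5` (consumed) and the tag `tag`
on `A2V`, and emitting it onto `L4`. [folklore] -/
def a2Emit (tag : Bool) : Com (EReg ⊕ β) :=
  ((NS.ofList [.len (h .X2) (h .A2T) (h .X3), .sub (h .X3) (h .A2D) (h .X2), .clear (h .X2), .move (h .X5) (h .A2V), .push (h .A2V) tag] : NS β).com) ;;
  (nToUnary (h .U2) (h .X3) ;; (((NS.op (.clear (h .X3))) : NS β).com ;; (countLoop (Sum.inr (h .U2)) (push (Sum.inr (h .A2V)) false) ;;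
  (((NS.op (.copy (h .A2T) (h .A2V))) : NS β).com ;; (emit (Sum.inr (h .A2V)) (Sum.inr (h .L4)) ;; push (Sum.inr (h .A2L1)) true)))))

/-- Cost of one word. [folklore] -/
def a2EmitCost (n : ℕ) : ℕ := 250 * (n + 1) ^ 3

/-- **Emitting one word.** [folklore] -/
theorem runs_a2Emit (tag : Bool) {N n v nb : ℕ} (hn : 2 * (encodeNat N).length + 8 ≤ n) (hnb : (encodeNat N).length = nb) (T : Regs β) (u : HSlots)
    (hvN : v < N) {pl : List Bool} (hpl : pl.length ≤ n) (ws : List (List Bool))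
    (ha2t : u.a2t = encodeNat v) (hx5 : u.x5 = pl) (ha2d : u.a2d = encodeNat nb) (hl4 : u.l4 = outRev ws) (ha2l1 : u.a2l1 = List.replicate ws.length true)
    (ha2v : u.a2v = []) (hx2 : u.x2 = []) (hx3 : u.x3 = []) (hu2 : u.u2 = []) :
    Runs (a2Emit h tag) (base (hSt h T u)) (base (hSt h T { u with x5 := [], l4 := outRev (ws ++ [mkWord nb v tag pl]), a2l1 := List.replicate (ws ++ [mkWord nb v tag pl]).length true })) (a2EmitCost n) := by
  set c := (n + 1) ^ 3 with hc3
  have hc1 : (n + 1) * (n + 1) ≤ c := by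
    rw [hc3]; calc (n + 1) * (n + 1) = (n + 1) ^ 2 := (sq _).symm
      _ ≤ (n + 1) ^ 3 := Nat.pow_le_pow_right (by omega) (by omega)
  have hc0 : n + 1 ≤ (n + 1) * (n + 1) := Nat.le_mul_of_pos_right _ (by omega)
  have hlN : (encodeNat N).length ≤ n := by omega
  have hlv : (encodeNat v).length ≤ nb := by rw [← hnb]; exact Brick.length_encodeNat_mono hvN.le
  have hnbn : nb ≤ n := by omega
  set pad := nb - (encodeNat v).length with hpad
  have hlpad : (encodeNat pad).length ≤ n := (Brick.length_encodeNat_mono (show pad ≤ nb by omega)).trans ((length_encodeNat_le_succ (le_two_pow_self nb)).trans (by omega))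
  have hlnb : (encodeNat nb).length ≤ n := (length_encodeNat_le_succ (le_two_pow_self nb)).trans (by omega)
  have hllen : (encodeNat (encodeNat v).length).length ≤ n := (Brick.length_encodeNat_mono hlv).trans hlnb
  let u1 : HSlots := { u with x3 := encodeNat pad, x5 := [], a2v := tag :: pl }
  have h1 : Runs ((NS.ofList [.len (h .X2) (h .A2T) (h .X3), .sub (h .X3) (h .A2D) (h .X2), .clear (h .X2), .move (h .X5) (h .A2V), .push (h .A2V) tag] : NS β).com)
      (base (hSt h T u)) (base (hSt h T u1)) (173 * c) := by
    generalize hlenv : (encodeNat v).length = lv at hllen hlv hpad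
    refine NS.runs_of_eq (N := n) _ _ ?_ ?_ (by simp [hc3])
    · simp (config := { decide := true }) only [NS.ofList, NS.ok, NOp.ok, NS.eval, NOp.eval, hSt_X2, hSt_A2T, hSt_X3, hSt_A2D, hSt_X5, update_hSt_X2, update_hSt_X3,
        ha2t, hx2, hx3, ha2d, hx5, ha2v, hlenv, bitsToNat_encodeNat, ne_eq, EmbeddingLike.apply_eq_iff_eq, List.length_nil, zero_le, and_self, hllen, hlnb, hpl,
        not_false_eq_true, true_and, and_true]
      omega
    · simp [u1, ha2t, hx2, hx3, ha2d, hx5, ha2v, hlenv, hpad]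
  let u2 : HSlots := { u1 with u2 := List.replicate pad true }
  have h2 : Runs (nToUnary (h .U2) (h .X3)) (base (hSt h T u1)) (base (hSt h T u2)) ((encodeNat pad).length * (16 * pad + 21) + 5) := by
    refine (runs_nToUnary (h .U2) (h .X3) (hSt h T u1) (by simp [u1, hu2])).of_eq (by simp [u1, u2]) ?_
    simp only [hSt_X3, u1, bitsToNat_encodeNat]; exact le_rfl
  let u3 : HSlots := { u2 with x3 := [] }
  have h3 : Runs ((NS.op (.clear (h .X3)) : NS β).com) (base (hSt h T u2)) (base (hSt h T u3)) (3 * c) :=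
    NS.runs_of_eq (N := n) _ _ (by simp only [NS.ok, NOp.ok, hSt_X3, u2, u1]; exact hlpad) (by simp [u2, u3]) (by simp [hc3])
  let st : ℕ → HSlots := fun i => { u3 with u2 := List.replicate i true, a2v := List.replicate (pad - i) false ++ tag :: pl }
  have hst : u3 = st pad := by simp [st, u3, u2, u1]
  have hL := runs_countLoop (U := (Sum.inr (h .U2) : EReg ⊕ β)) (body := push (Sum.inr (h .A2V)) false) (fun i R => i ≤ pad ∧ R = base (hSt h T (st i))) 1
    (by
      rintro i R ⟨hi, rfl⟩ -
      refine ⟨base (hSt h T (st i)), Runs.push' ?_, by simp [st], by omega, rfl⟩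
      have e : pad - i = (pad - (i + 1)) + 1 := by omega
      simp [st, e, List.replicate_succ])
    pad (base (hSt h T (st pad))) ⟨le_rfl, rfl⟩ (by simp [st])
  obtain ⟨R', hR, -, -, rfl⟩ := hL
  rw [← hst] at hR
  let u4 : HSlots := { st 0 with a2v := encodeNat v ++ (List.replicate pad false ++ tag :: pl) }
  have h4 : Runs ((NS.op (.copy (h .A2T) (h .A2V)) : NS β).com) (base (hSt h T (st 0))) (base (hSt h T u4)) (13 * c) := by
    refine NS.runs_of_eq (N := n) _ _ ?_ (by simp [st, u4, u3, u2, u1, ha2t]) (by simp [hc3])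
    simp (config := { decide := true }) only [NS.ok, NOp.ok, hSt_A2T, st, u3, u2, u1, ha2t, ne_eq, EmbeddingLike.apply_eq_iff_eq, not_false_eq_true, true_and]
    exact hlv.trans hnbn
  have hwl : (encodeNat v ++ (List.replicate pad false ++ tag :: pl)).length ≤ 2 * n + 1 := by
    simp only [List.length_append, List.length_replicate, List.length_cons]; omega
  let u5 : HSlots := { u with x5 := [], l4 := outRev (ws ++ [mkWord nb v tag pl]) }
  have h5 : Runs (emit (Sum.inr (h .A2V)) (Sum.inr (h .L4))) (base (hSt h T u4)) (base (hSt h T u5)) (4 * (2 * n + 1) + 3) := by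
    refine (runs_emit (h := (Sum.inr (h .A2V) : EReg ⊕ β)) (o := Sum.inr (h .L4)) (by simp [hq_ne h (show HReg.A2V ≠ .L4 by decide)]) (base (hSt h T u4))).of_eq ?_ ?_
    · simp [u4, u5, st, u3, u2, u1, hl4, hx3, hu2, ha2v, outRev_append, mkWord, hpad]
    · simp only [nst_inr, hSt_A2V, u4]; omega
  have h6 : Runs (push (Sum.inr (h .A2L1)) true) (base (hSt h T u5))
      (base (hSt h T { u with x5 := [], l4 := outRev (ws ++ [mkWord nb v tag pl]), a2l1 := List.replicate (ws ++ [mkWord nb v tag pl]).length true })) 1 :=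
    Runs.push' (by simp [u5, ha2l1, List.replicate_succ])
  refine (h1.seq (h2.seq (h3.seq (hR.seq (h4.seq (h5.seq h6)))))).of_eq rfl ?_
  have hp1 : (encodeNat pad).length * (16 * pad + 21) ≤ (n + 1) * (37 * (n + 1)) := Nat.mul_le_mul (by omega) (by omega)
  have hp2 : (n + 1) * (37 * (n + 1)) ≤ 37 * c := by rw [hc3]; nlinarith
  have hpadn : pad ≤ n := by omega
  have hc0' : n + 1 ≤ c := hc0.trans hc1
  simp only [a2EmitCost, ← hc3]
  omega

end AlgTwoEmit

section AlgTwoBaby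

/-! #### Step 3, first list: the baby-step words `(C α^i, i)`, `0 ≤ i < m` -/

/-- The baby-step value `C α^i mod N`. [folklore] -/
def bval (N α C i : ℕ) : ℕ := C * α ^ i % N

/-- The baby-step words. [folklore] -/
def babyWords (N α C nb j : ℕ) : List (List Bool) := (List.range j).map fun i => mkWord nb (bval N α C i) false (encodeNat i)

/-- `babyWords` grows by one word. [folklore] -/
theorem babyWords_succ (N α C nb j : ℕ) : babyWords N α C nb (j + 1) = babyWords N α C nb j ++ [mkWord nb (bval N α C j) false (encodeNat j)] := by
  simp [babyWords, List.range_succ]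

/-- The next baby-step value. [folklore] -/
theorem bval_succ (N α C i : ℕ) : bval N α C (i + 1) = bval N α C i * α % N := by
  simp only [bval, pow_succ, ← mul_assoc]; rw [Nat.mul_mod (C * α ^ i) α, Nat.mul_mod (C * α ^ i % N) α, Nat.mod_mod]

/-- One baby-step word: payload `i`, the word, the next value and index. [folklore] -/
def a2BabyBody : Com (EReg ⊕ β) :=
  ((NS.op (.copy (h .A2J) (h .X5)) : NS β).com) ;; (a2Emit h false ;;
  ((NS.ofList [.mulMod (h .A2T) (h .BLA) (h (.g (.f (.n (.v .MD))))), .succ (h .X4) (h .A2J), .clear (h .A2J), .move (h .X4) (h .A2J)] : NS β).com))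

/-- The baby-step words: value `C`, index `0`, `m` rounds, clean-up. [folklore] -/
def a2Baby : Com (EReg ⊕ β) :=
  ((NS.op (.copy (h .A2C) (h .A2T)) : NS β).com) ;; (nToUnary (h .U1) (h .A2Y) ;; (countLoop (Sum.inr (h .U1)) (a2BabyBody h) ;;
  ((NS.ofList [.clear (h .A2T), .clear (h .A2J)] : NS β).com)))

/-- The state of the baby-step pass after `j` words, `i` rounds to go. [folklore] -/
def HSlots.babyAt (u : HSlots) (N α C nb : ℕ) (ws : List (List Bool)) (i j : ℕ) : HSlots :=
  { u with u1 := List.replicate i true, a2t := encodeNat (bval N α C j), a2j := encodeNat j, l4 := outRev (ws ++ babyWords N α C nb j),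
           a2l1 := List.replicate (ws ++ babyWords N α C nb j).length true }

/-- One round of the baby-step pass. [folklore] -/
theorem runs_a2BabyBody {N n α C nb i j : ℕ} (hN1 : 1 < N) (hn : 2 * (encodeNat N).length + 8 ≤ n) (hnb : (encodeNat N).length = nb) (T : Regs β) (hI : DrvInv (rGH h) N T)
    (u : HSlots) (hαN : α < N) (hjN : j + 1 ≤ N) (ws : List (List Bool)) (hbla : u.bla = encodeNat α) (ha2d : u.a2d = encodeNat nb)
    (hx5 : u.x5 = []) (ha2v : u.a2v = []) (hx2 : u.x2 = []) (hx3 : u.x3 = []) (hx4 : u.x4 = []) (hu2 : u.u2 = []) :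
    Runs (a2BabyBody h) (base (hSt h T { u.babyAt N α C nb ws (i + 1) j with u1 := List.replicate i true })) (base (hSt h T (u.babyAt N α C nb ws i (j + 1)))) (1286 * (n + 1) ^ 3) := by
  have hN0 : 0 < N := by omega
  obtain ⟨hMD, -, -, -, -, -, -, -, -, -, -, -, -, -, -, -, -, -⟩ := id hI
  have rdMD : ∀ u' : HSlots, hSt h T u' (h (.g (.f (.n (.v .MD))))) = encodeNat N := fun u' => by
    rw [hSt_gv h T u' (by decide) (by decide) (by decide) (by decide) (by decide) (by decide)]; exact hMD
  set c := (n + 1) ^ 3 with hc3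
  have hlN : (encodeNat N).length ≤ n := by omega
  have hlα : (encodeNat α).length ≤ n := (Brick.length_encodeNat_mono hαN.le).trans hlN
  have hvN : bval N α C j < N := Nat.mod_lt _ hN0
  have hlv : (encodeNat (bval N α C j)).length ≤ n := (Brick.length_encodeNat_mono hvN.le).trans hlN
  have hlv' : (encodeNat (bval N α C j * α % N)).length ≤ n := (Brick.length_encodeNat_mono (Nat.mod_lt _ hN0).le).trans hlN
  have hlj : (encodeNat j).length ≤ n := (Brick.length_encodeNat_mono (by omega : j ≤ N)).trans hlN
  have hlj1 : (encodeNat (j + 1)).length ≤ n := (Brick.length_encodeNat_mono hjN).trans hlN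
  let v : HSlots := { u with u1 := List.replicate i true, a2t := encodeNat (bval N α C j), a2j := encodeNat j, l4 := outRev (ws ++ babyWords N α C nb j), a2l1 := List.replicate (ws ++ babyWords N α C nb j).length true }
  have hv : ({ u.babyAt N α C nb ws (i + 1) j with u1 := List.replicate i true } : HSlots) = v := by simp [HSlots.babyAt, v]
  rw [hv]
  let v1 : HSlots := { v with x5 := encodeNat j }
  have h1 : Runs ((NS.op (.copy (h .A2J) (h .X5)) : NS β).com) (base (hSt h T v)) (base (hSt h T v1)) (13 * c) := by
    refine NS.runs_of_eq (N := n) _ _ ?_ (by simp [v, v1, hx5]) (by simp [hc3])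
    simp (config := { decide := true }) only [NS.ok, NOp.ok, hSt_A2J, v, ne_eq, EmbeddingLike.apply_eq_iff_eq, not_false_eq_true, true_and]; exact hlj
  have h2 := runs_a2Emit h false (N := N) (v := bval N α C j) hn hnb T v1 hvN (pl := encodeNat j) hlj (ws ++ babyWords N α C nb j) (by simp [v1, v]) (by simp [v1]) (by simp [v1, v, ha2d])
    (by simp [v1, v]) (by simp [v1, v]) (by simp [v1, v, ha2v]) (by simp [v1, v, hx2]) (by simp [v1, v, hx3]) (by simp [v1, v, hu2])
  let wsb := ws ++ babyWords N α C nb j ++ [mkWord nb (bval N α C j) false (encodeNat j)]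
  let v2 : HSlots := { v1 with x5 := [], l4 := outRev wsb, a2l1 := List.replicate wsb.length true }
  have h3 : Runs ((NS.ofList [.mulMod (h .A2T) (h .BLA) (h (.g (.f (.n (.v .MD))))), .succ (h .X4) (h .A2J), .clear (h .A2J), .move (h .X4) (h .A2J)] : NS β).com)
      (base (hSt h T v2)) (base (hSt h T (u.babyAt N α C nb ws i (j + 1)))) (1023 * c) := by
    refine NS.runs_of_eq (N := n) _ _ ?_ ?_ (by simp [hc3])
    · simp (config := { decide := true }) only [NS.ofList, NS.ok, NOp.ok, NS.eval, NOp.eval, hSt_A2T, hSt_BLA, hSt_X4, hSt_A2J, update_hSt_A2T, update_hSt_X4, update_hSt_A2J,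
        v2, wsb, v1, v, hbla, hx4, rdMD, bitsToNat_encodeNat, ne_eq, EmbeddingLike.apply_eq_iff_eq, List.length_nil, zero_le, and_self, hlv, hlα, hlN, hN0, hlj, hlj1, not_false_eq_true]
    · simp [v2, wsb, v1, v, HSlots.babyAt, hbla, hx4, rdMD, bval_succ, babyWords_succ, hx5]
  refine (h1.seq (h2.seq h3)).of_eq rfl ?_
  simp only [a2EmitCost, ← hc3]; omega

/-- Cost of the baby-step pass. [folklore] -/
def a2BabyCost (n m : ℕ) : ℕ := 19 * (n + 1) ^ 3 + ((encodeNat m).length * (16 * m + 21) + 5) + (m * (1286 * (n + 1) ^ 3 + 2) + 1)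

/-- **The baby-step words.** [folklore] -/
theorem runs_a2Baby {N n α C m nb : ℕ} (hN1 : 1 < N) (hn : 2 * (encodeNat N).length + 8 ≤ n) (hnb : (encodeNat N).length = nb) (T : Regs β) (hI : DrvInv (rGH h) N T)
    (u : HSlots) (hαN : α < N) (hCN : C < N) (hmN : m ≤ N) (ws : List (List Bool)) (hbla : u.bla = encodeNat α) (ha2d : u.a2d = encodeNat nb) (ha2c : u.a2c = encodeNat C)
    (ha2y : u.a2y = encodeNat m) (hl4 : u.l4 = outRev ws) (ha2l1 : u.a2l1 = List.replicate ws.length true) (ha2t : u.a2t = []) (ha2j : u.a2j = []) (hu1 : u.u1 = [])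
    (hx5 : u.x5 = []) (ha2v : u.a2v = []) (hx2 : u.x2 = []) (hx3 : u.x3 = []) (hx4 : u.x4 = []) (hu2 : u.u2 = []) :
    Runs (a2Baby h) (base (hSt h T u)) (base (hSt h T { u with l4 := outRev (ws ++ babyWords N α C nb m), a2l1 := List.replicate (ws ++ babyWords N α C nb m).length true })) (a2BabyCost n m) := by
  have hN0 : 0 < N := by omega
  set c := (n + 1) ^ 3 with hc3
  have hlN : (encodeNat N).length ≤ n := by omega
  have hlC : (encodeNat C).length ≤ n := (Brick.length_encodeNat_mono hCN.le).trans hlN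
  have hlv : ∀ j, (encodeNat (bval N α C j)).length ≤ n := fun j => (Brick.length_encodeNat_mono (Nat.mod_lt _ hN0).le).trans hlN
  have hlm : (encodeNat m).length ≤ n := (Brick.length_encodeNat_mono hmN).trans hlN
  have hb0 : bval N α C 0 = C := by simp [bval, Nat.mod_eq_of_lt hCN]
  let u0 : HSlots := { u with a2t := encodeNat C }
  have h0 : Runs ((NS.op (.copy (h .A2C) (h .A2T)) : NS β).com) (base (hSt h T u)) (base (hSt h T u0)) (13 * c) := by
    refine NS.runs_of_eq (N := n) _ _ ?_ (by simp [u0, ha2t, ha2c]) (by simp [hc3])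
    simp (config := { decide := true }) only [NS.ok, NOp.ok, hSt_A2C, ha2c, ne_eq, EmbeddingLike.apply_eq_iff_eq, not_false_eq_true, true_and]; exact hlC
  have hstart : u.babyAt N α C nb ws m 0 = { u0 with u1 := List.replicate m true } := by
    simp [HSlots.babyAt, u0, babyWords, hb0, ha2j, hl4, ha2l1, show encodeNat 0 = [] from rfl]
  have h1 : Runs (nToUnary (h .U1) (h .A2Y)) (base (hSt h T u0)) (base (hSt h T (u.babyAt N α C nb ws m 0))) ((encodeNat m).length * (16 * m + 21) + 5) := by
    refine (runs_nToUnary (h .U1) (h .A2Y) (hSt h T u0) (by simp [u0, hu1])).of_eq (by rw [hstart]; simp [u0, ha2y]) ?_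
    simp only [hSt_A2Y, u0, ha2y, bitsToNat_encodeNat]; exact le_rfl
  have hL := runs_countLoop (U := (Sum.inr (h .U1) : EReg ⊕ β)) (body := a2BabyBody h) (fun i R => i ≤ m ∧ R = base (hSt h T (u.babyAt N α C nb ws i (m - i)))) (1286 * c)
    (by
      rintro i R ⟨hi, rfl⟩ -
      have hupd : Function.update (base (hSt h T (u.babyAt N α C nb ws (i + 1) (m - (i + 1))))) (Sum.inr (h .U1)) (List.replicate i true) =
          base (hSt h T { u.babyAt N α C nb ws (i + 1) (m - (i + 1)) with u1 := List.replicate i true }) := by simp [HSlots.babyAt]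
      rw [hupd]
      have hj : m - i = m - (i + 1) + 1 := by omega
      refine ⟨_, runs_a2BabyBody h hN1 hn hnb T hI u hαN (by omega) ws hbla ha2d hx5 ha2v hx2 hx3 hx4 hu2, by simp [HSlots.babyAt], by omega, by rw [hj]⟩)
    m (base (hSt h T (u.babyAt N α C nb ws m 0))) ⟨le_rfl, by simp⟩ (by rw [hstart]; simp [u0])
  obtain ⟨R', hR, -, -, rfl⟩ := hL
  simp only [Nat.sub_zero] at hR
  have h3 : Runs ((NS.ofList [.clear (h .A2T), .clear (h .A2J)] : NS β).com) (base (hSt h T (u.babyAt N α C nb ws 0 m)))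
      (base (hSt h T { u with l4 := outRev (ws ++ babyWords N α C nb m), a2l1 := List.replicate (ws ++ babyWords N α C nb m).length true })) (6 * c) := by
    refine NS.runs_of_eq (N := n) _ _ ?_ (by simp [HSlots.babyAt, ha2t, ha2j, hu1]) (by simp [hc3])
    simp only [NS.ofList, NS.ok, NOp.ok, NS.eval, NOp.eval, hSt_A2T, hSt_A2J, update_hSt_A2T, HSlots.babyAt]
    exact ⟨hlv m, hlm, trivial⟩
  refine (h0.seq (h1.seq (hR.seq h3))).of_eq rfl ?_
  simp only [a2BabyCost, ← hc3]; omega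

end AlgTwoBaby

section AlgTwoGiant

/-! #### Step 2/3, second list: the giant-step words `(ṽ_{a,b,j}, a, b, j)`

For `1 ≤ a ≤ r`, `1 ≤ b ≤ ⌊r/a⌋`: `x = 4abN`, `⌈√x⌉`, `E = aN + b − ⌈√x⌉`, `t = α^E`, `q = ⌊√(ab)⌋`,
`J = ⌊S/(4rm·q)⌋ + 1`, and the words of `w_{jj} = t·α^{(J* − J + 1 + jj)m}` with payload
`(a, b, J − 1 − jj)`, `0 ≤ jj < J` — i.e. `ṽ_{a,b,j} = t·α^{(J*−j)m}` for `0 ≤ j < J`, the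
inverse-free form of Harvey's `v_{a,b,j} = t·α^{−jm}` (all keys multiplied by `α^{J* m}`). -/

/-- `⌈√x⌉`. [folklore] -/
def ceilSqrt (x : ℕ) : ℕ := if Nat.sqrt x * Nat.sqrt x = x then Nat.sqrt x else Nat.sqrt x + 1

/-- The exponent of `t_{a,b}`. [folklore] -/
def tExp (N a b : ℕ) : ℕ := a * N + b - ceilSqrt (4 * a * b * N)

/-- The number of giant steps `J_{a,b}`. [folklore] -/
def jCount (N m r a b : ℕ) : ℕ := (Nat.sqrt N + 1) / (4 * r * m * Nat.sqrt (a * b)) + 1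

/-- The first giant-step value `w_0 = t·α^{(J*−J+1)m}`. [folklore] -/
def gStart (N α m r a b : ℕ) : ℕ := α ^ tExp N a b % N * (α ^ ((a2JStar N m r - jCount N m r a b + 1) * m) % N) % N

/-- The giant-step values `w_{jj} = w_0 · (α^m)^{jj}`. [folklore] -/
def gVal (N α m r a b : ℕ) : ℕ → ℕ
  | 0 => gStart N α m r a b
  | jj + 1 => gVal N α m r a b jj * (α ^ m % N) % N

/-- The payload `(a, b, j)`. [folklore] -/
def gPayload (a b j : ℕ) : List Bool := boolPair (encodeNat a) (boolPair (encodeNat b) (encodeNat j))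

/-- The words of one pair `(a, b)`: `jj` of them. [folklore] -/
def pairWords (N α m r nb a b jj : ℕ) : List (List Bool) :=
  (List.range jj).map fun i => mkWord nb (gVal N α m r a b i) true (gPayload a b (jCount N m r a b - 1 - i))

/-- The words of the pairs `(a, 1), …, (a, b)`. [folklore] -/
def rowWords (N α m r nb a : ℕ) : ℕ → List (List Bool)
  | 0 => []
  | b + 1 => rowWords N α m r nb a b ++ pairWords N α m r nb a (b + 1) (jCount N m r a (b + 1))

/-- The words of the rows `1, …, a`. [folklore] -/
def giantWords (N α m r nb : ℕ) : ℕ → List (List Bool)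
  | 0 => []
  | a + 1 => giantWords N α m r nb a ++ rowWords N α m r nb (a + 1) (r / (a + 1))

/-- `pairWords` grows by one word. [folklore] -/
theorem pairWords_succ (N α m r nb a b jj : ℕ) :
    pairWords N α m r nb a b (jj + 1) = pairWords N α m r nb a b jj ++ [mkWord nb (gVal N α m r a b jj) true (gPayload a b (jCount N m r a b - 1 - jj))] := by
  simp [pairWords, List.range_succ]

/-- Size facts of the pair computations: everything is below `4N²`. [folklore] -/
theorem a2_len4 {N n : ℕ} (hN1 : 1 < N) (hn : 2 * (encodeNat N).length + 8 ≤ n) {y : ℕ} (hy : y ≤ 4 * N * N) : (encodeNat y).length ≤ n := by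
  have hN0 : 0 < N := by omega
  have h1 : (encodeNat (2 * N)).length = (encodeNat N).length + 1 := by rw [encodeNat_two_mul _ hN0]; rfl
  have h2 := length_encodeNat_mul_le (2 * N) (2 * N)
  have h3 := Brick.length_encodeNat_mono (show y ≤ 2 * N * (2 * N) by nlinarith)
  omega

/-- `x = 4abN` on `SFE`, `ab` on `X2`. [folklore] -/
def a2PairX : NS β :=
  NS.ofList [.mul (h .X2) (h .A2A) (h .A2B), .add (h .X3) (h .X2) (h .X2), .add (h .X4) (h .X3) (h .X3), .mul (h .SFE) (h .X4) (h (.g (.f (.n (.v .MD))))),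
    .clear (h .X3), .clear (h .X4)]

/-- `SQ1 := ⌈√x⌉` from `SQ1 = ⌊√x⌋`. [folklore] -/
def a2Ceil : NS β :=
  NS.seq (NS.ofList [.mul (h .X3) (h .SQ1) (h .SQ1), .eq (h .FL1) (h .X3) (h .SFE) (h .X4), .clear (h .X3)])
    (NS.ite (h .FL1) NS.nop (NS.ofList [.succ (h .X3) (h .SQ1), .clear (h .SQ1), .move (h .X3) (h .SQ1)]))

/-- First part of a pair: `X2 := ab`, `SFE := 4abN`, `SQ1 := ⌈√(4abN)⌉`. [folklore] -/
def a2PairA : Com (EReg ⊕ β) := (a2PairX h).com ;; (isqrtAt h .SFE ;; (a2Ceil h).com)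

/-- **First part of a pair.** [folklore] -/
theorem runs_a2PairA {N n a b r : ℕ} (hN1 : 1 < N) (hn : 2 * (encodeNat N).length + 8 ≤ n) (T : Regs β) (hI : DrvInv (rGH h) N T) (u : HSlots)
    (ha1 : 1 ≤ a) (hb1 : 1 ≤ b) (habr : a * b ≤ r) (hrN : r ≤ N) (ha2a : u.a2a = encodeNat a) (ha2b : u.a2b = encodeNat b)
    (hx2 : u.x2 = []) (hx3 : u.x3 = []) (hx4 : u.x4 = []) (hsfe : u.sfe = []) (hfl1 : u.fl1 = [])
    (hsq1 : u.sq1 = []) (hsq2 : u.sq2 = []) (hsq3 : u.sq3 = []) (hsq4 : u.sq4 = []) (hsq5 : u.sq5 = []) (hx6 : u.x6 = []) :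
    Runs (a2PairA h) (base (hSt h T u)) (base (hSt h T { u with x2 := encodeNat (a * b), sfe := encodeNat (4 * a * b * N), sq1 := encodeNat (ceilSqrt (4 * a * b * N)) }))
      (1151 * (n + 1) ^ 3 + isqrtCost n) := by
  have hN0 : 0 < N := by omega
  obtain ⟨hMD, -, -, -, -, -, -, -, -, -, -, -, -, -, -, -, -, -⟩ := id hI
  have rdMD : ∀ u' : HSlots, hSt h T u' (h (.g (.f (.n (.v .MD))))) = encodeNat N := fun u' => by
    rw [hSt_gv h T u' (by decide) (by decide) (by decide) (by decide) (by decide) (by decide)]; exact hMD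
  set c := (n + 1) ^ 3 with hc3
  have hl := fun (y : ℕ) (hy : y ≤ 4 * N * N) => a2_len4 hN1 hn hy
  have habN : a * b ≤ N := habr.trans hrN
  have haN : a ≤ N := le_trans (Nat.le_mul_of_pos_right _ hb1) habN
  have hbN : b ≤ N := le_trans (Nat.le_mul_of_pos_left _ ha1) habN
  have hNN : N ≤ 4 * N * N := by nlinarith
  set x := 4 * a * b * N with hx0
  have hxle : x ≤ 4 * N * N := by rw [hx0]; nlinarith
  have e2ab : a * b + a * b + (a * b + a * b) = 4 * a * b := by ring
  have hlN := hl N hNN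
  have hla := hl a (haN.trans hNN)
  have hlb := hl b (hbN.trans hNN)
  have hlab := hl (a * b) (habN.trans hNN)
  have hl2ab := hl (a * b + a * b) (by nlinarith)
  have hl4ab := hl (4 * a * b) (by nlinarith)
  have hlx := hl x hxle
  let u1 : HSlots := { u with x2 := encodeNat (a * b), sfe := encodeNat x }
  have h1 : Runs (a2PairX h).com (base (hSt h T u)) (base (hSt h T u1)) (676 * c) := by
    refine NS.runs_of_eq (N := n) _ _ ?_ ?_ (by simp [hc3, a2PairX])
    · simp (config := { decide := true }) only [a2PairX, NS.ofList, NS.ok, NOp.ok, NS.eval, NOp.eval, hSt_X2, hSt_A2A, hSt_A2B, hSt_X3, hSt_X4, hSt_SFE, update_hSt_X2, update_hSt_X3,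
        update_hSt_X4, update_hSt_SFE, ha2a, ha2b, hx2, hx3, hx4, hsfe, rdMD, bitsToNat_encodeNat, List.length_nil, zero_le, and_self, hla, hlb,
        hlab, hl2ab, e2ab, hl4ab, hlN]
    · simp [a2PairX, u1, ha2a, ha2b, hx3, hx4, hsfe, rdMD, e2ab, hx0]
  let u2 : HSlots := { u1 with sq1 := encodeNat (Nat.sqrt x) }
  have h2 : Runs (isqrtAt h .SFE) (base (hSt h T u1)) (base (hSt h T u2)) (isqrtCost n) :=
    runs_isqrtAt h (S := .SFE) (by decide) hlx T u1 (by simp [u1]) (by simp [u1, hsq1]) (by simp [u1, hsq2]) (by simp [u1, hsq3]) (by simp [u1, hsq4]) (by simp [u1, hsq5]) (by simp [u1, hx6])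
  have hs2 : Nat.sqrt x * Nat.sqrt x ≤ x := Nat.sqrt_le x
  have hsx : Nat.sqrt x ≤ x := Nat.sqrt_le_self x
  have hls := hl (Nat.sqrt x) (hsx.trans hxle)
  have hls2 := hl (Nat.sqrt x * Nat.sqrt x) (hs2.trans hxle)
  have hls1 : (encodeNat (Nat.sqrt x + 1)).length ≤ n := by
    have : Nat.sqrt x ≤ 2 * N := by
      have h' : x ≤ (2 * N) * (2 * N) := by nlinarith
      have := Nat.sqrt_le_sqrt h'; rwa [Nat.sqrt_eq] at this
    exact hl _ (by nlinarith)
  have h3 : Runs (a2Ceil h).com (base (hSt h T u2)) (base (hSt h T { u with x2 := encodeNat (a * b), sfe := encodeNat x, sq1 := encodeNat (ceilSqrt x) })) (475 * c) := by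
    by_cases hsq : Nat.sqrt x * Nat.sqrt x = x
    · have hce : ceilSqrt x = Nat.sqrt x := by simp [ceilSqrt, hsq]
      refine NS.runs_of_eq (N := n) _ _ ?_ ?_ (by simp [hc3, a2Ceil])
      · simp (config := { decide := true }) only [a2Ceil, NS.ofList, NS.ok, NOp.ok, NS.eval, NOp.eval, hSt_X3, hSt_SQ1, hSt_FL1, hSt_SFE, hSt_X4, update_hSt_X3, update_hSt_FL1,
          u2, u1, hx3, hx4, hfl1, bitsToNat_encodeNat, hsq, ne_eq, EmbeddingLike.apply_eq_iff_eq, List.length_nil, zero_le, and_self, hls, hlx, not_false_eq_true, decide_true,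
          flag_true, true_and, true_or]
      · simp [a2Ceil, u2, u1, hx3, hx4, hfl1, hsq, hce]
    · have hce : ceilSqrt x = Nat.sqrt x + 1 := by simp [ceilSqrt, hsq]
      refine NS.runs_of_eq (N := n) _ _ ?_ ?_ (by simp [hc3, a2Ceil])
      · simp (config := { decide := true }) only [a2Ceil, NS.ofList, NS.ok, NOp.ok, NS.eval, NOp.eval, hSt_X3, hSt_SQ1, hSt_FL1, hSt_SFE, hSt_X4, update_hSt_X3, update_hSt_FL1,
          update_hSt_SQ1, u2, u1, hx3, hx4, hfl1, bitsToNat_encodeNat, hsq, ne_eq, EmbeddingLike.apply_eq_iff_eq, List.length_nil, zero_le, and_self, hls, hls2, hlx, hls1,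
          not_false_eq_true, decide_false, flag_false, or_true, and_true]
      · simp [a2Ceil, u2, u1, hx3, hx4, hfl1, hsq, hce]
  refine (h1.seq (h2.seq h3)).of_eq rfl ?_
  omega

/-- `⌈√(4abN)⌉ ≤ aN + b` (AM–GM). [folklore] -/
theorem ceilSqrt_le (N a b : ℕ) : ceilSqrt (4 * a * b * N) ≤ a * N + b := by
  have key : 4 * a * b * N ≤ (a * N + b) * (a * N + b) := by nlinarith [sq_nonneg ((a * N : ℤ) - b)]
  unfold ceilSqrt
  split_ifs with hsq
  · exact Nat.sqrt_le_sqrt key |>.trans_eq (Nat.sqrt_eq _)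
  · have h1 : Nat.sqrt (4 * a * b * N) ≤ a * N + b := Nat.sqrt_le_sqrt key |>.trans_eq (Nat.sqrt_eq _)
    rcases h1.lt_or_eq with hlt | heq
    · exact hlt
    · exfalso; apply hsq
      apply le_antisymm (Nat.sqrt_le _)
      rw [heq]; exact key

/-- `⌈√x⌉ ≤ √x + 1 ≤ 2N + 1` for `x ≤ 4N²`. [folklore] -/
theorem ceilSqrt_le_two_mul {N x : ℕ} (hx : x ≤ 4 * N * N) : ceilSqrt x ≤ 2 * N + 1 := by
  have : Nat.sqrt x ≤ 2 * N := by
    have h' : x ≤ (2 * N) * (2 * N) := by nlinarith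
    have := Nat.sqrt_le_sqrt h'; rwa [Nat.sqrt_eq] at this
  unfold ceilSqrt; split_ifs <;> omega

/-- `t = α^E` on `A2T`, `E = aN + b − ⌈√(4abN)⌉` (consuming `SQ1`). [folklore] -/
def a2PairT : NS β :=
  NS.ofList [.mul (h .X3) (h .A2A) (h (.g (.f (.n (.v .MD))))), .add (h .X4) (h .X3) (h .A2B), .clear (h .X3), .sub (h .X3) (h .X4) (h .SQ1), .clear (h .X4), .clear (h .SQ1),
    .powMod (h .A2T) (h .BLA) (h .X3) (h (.g (.f (.n (.v .MD))))), .clear (h .X3)]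

/-- `J = ⌊S/(4rm·q)⌋ + 1` on `SFCAND` from `q = ⌊√(ab)⌋` on `SQ1` (consuming `SQ1`, `X2`, `SFE`). [folklore] -/
def a2PairJ : NS β :=
  NS.ofList [.mul (h .X3) (h .A2AL) (h .SQ1), .clear (h .SQ1), .divMod (h .X4) (h .X6) (h .A2S) (h .X3), .clear (h .X6), .clear (h .X3), .succ (h .SFCAND) (h .X4),
    .clear (h .X4), .clear (h .X2), .clear (h .SFE)]

/-- Second part of a pair: `A2T := t`, `SFCAND := J`. [folklore] -/
def a2PairB : Com (EReg ⊕ β) := (a2PairT h).com ;; (isqrtAt h .X2 ;; (a2PairJ h).com)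

/-- The exponent block, on abstract operands. [folklore] -/
theorem runs_a2PairT {N n α a b ce : ℕ} (hN1 : 1 < N) (hn : 2 * (encodeNat N).length + 8 ≤ n) (T : Regs β) (hI : DrvInv (rGH h) N T) (u : HSlots)
    (hαN : α < N) (haNb : a * N + b ≤ 4 * N * N) (hce : ce ≤ a * N + b)
    (hbla : u.bla = encodeNat α) (ha2a : u.a2a = encodeNat a) (ha2b : u.a2b = encodeNat b) (hsq1 : u.sq1 = encodeNat ce) (hx3 : u.x3 = []) (hx4 : u.x4 = []) (ha2t : u.a2t = []) :
    Runs (a2PairT h).com (base (hSt h T u)) (base (hSt h T { u with sq1 := [], a2t := encodeNat (α ^ (a * N + b - ce) % N) })) (2318 * (n + 1) ^ 3) := by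
  have hN0 : 0 < N := by omega
  obtain ⟨hMD, -, -, -, -, -, -, -, -, -, -, -, -, -, -, -, -, -⟩ := id hI
  have rdMD : ∀ u' : HSlots, hSt h T u' (h (.g (.f (.n (.v .MD))))) = encodeNat N := fun u' => by
    rw [hSt_gv h T u' (by decide) (by decide) (by decide) (by decide) (by decide) (by decide)]; exact hMD
  have hl := fun (y : ℕ) (hy : y ≤ 4 * N * N) => a2_len4 hN1 hn hy
  have hNN : N ≤ 4 * N * N := by nlinarith
  have haN' : a * N ≤ 4 * N * N := by omega
  have ha' : a ≤ 4 * N * N := le_trans (Nat.le_mul_of_pos_right _ hN0) haN'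
  have hlN := hl N hNN
  have hlα := hl α (hαN.le.trans hNN)
  have hla := hl a ha'
  have hlb := hl b (by omega)
  have hlaN := hl (a * N) haN'
  have hlaNb := hl (a * N + b) haNb
  have hlce := hl ce (hce.trans haNb)
  have hlE := hl (a * N + b - ce) ((Nat.sub_le _ _).trans haNb)
  have hlt := hl (α ^ (a * N + b - ce) % N) ((Nat.mod_lt _ hN0).le.trans hNN)
  refine NS.runs_of_eq (N := n) _ _ ?_ ?_ (by simp [a2PairT])
  · simp (config := { decide := true }) only [a2PairT, NS.ofList, NS.ok, NOp.ok, NS.eval, NOp.eval, hSt_X3, hSt_A2A, hSt_X4, hSt_A2B, hSt_SQ1, hSt_A2T, hSt_BLA, update_hSt_X3,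
      update_hSt_X4, update_hSt_SQ1, update_hSt_A2T, ha2a, ha2b, hx3, hx4, hsq1, ha2t, hbla, rdMD, bitsToNat_encodeNat, ne_eq, EmbeddingLike.apply_eq_iff_eq, List.length_nil,
      zero_le, and_self, hla, hlb, hlN, hlaN, hlaNb, hlce, hce, hlE, hlα, hN1, not_false_eq_true]
  · simp [a2PairT, ha2a, ha2b, hx3, hx4, hsq1, ha2t, hbla, rdMD]

/-- The step-count block, on abstract operands. [folklore] -/
theorem runs_a2PairJ {N n q X S : ℕ} (hN1 : 1 < N) (hn : 2 * (encodeNat N).length + 8 ≤ n) (T : Regs β) (u : HSlots)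
    (hq1 : 1 ≤ q) (hX1 : 1 ≤ X) (hXq : X * q ≤ 4 * N * N) (hS : S ≤ N)
    (ha2al : u.a2al = encodeNat X) (ha2s : u.a2s = encodeNat S) (hsq1 : u.sq1 = encodeNat q) {wx we : List Bool} (hx2 : u.x2 = wx) (hwx : wx.length ≤ n) (hsfe : u.sfe = we) (hwe : we.length ≤ n)
    (hx3 : u.x3 = []) (hx4 : u.x4 = []) (hsfcand : u.sfcand = []) (hx6 : u.x6 = []) :
    Runs (a2PairJ h).com (base (hSt h T u)) (base (hSt h T { u with x2 := [], sfe := [], sq1 := [], sfcand := encodeNat (S / (X * q) + 1) })) (710 * (n + 1) ^ 3) := by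
  have hN0 : 0 < N := by omega
  have hl := fun (y : ℕ) (hy : y ≤ 4 * N * N) => a2_len4 hN1 hn hy
  have hNN : N ≤ 4 * N * N := by nlinarith
  have hXq0 : 0 < X * q := Nat.mul_pos (by omega) (by omega)
  have hlq := hl q (le_trans (Nat.le_mul_of_pos_left _ (by omega)) hXq)
  have hlX := hl X (le_trans (Nat.le_mul_of_pos_right _ (by omega)) hXq)
  have hlXq := hl (X * q) hXq
  have hlS := hl S (hS.trans hNN)
  have hJ0 : S / (X * q) ≤ S := Nat.div_le_self _ _
  have hlJ0 := hl (S / (X * q)) (hJ0.trans (hS.trans hNN))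
  have hlJr := hl (S % (X * q)) ((Nat.mod_le _ _).trans (hS.trans hNN))
  have hlJ := hl (S / (X * q) + 1) (by nlinarith)
  refine NS.runs_of_eq (N := n) _ _ ?_ ?_ (by simp [a2PairJ])
  · simp (config := { decide := true }) only [a2PairJ, NS.ofList, NS.ok, NOp.ok, NS.eval, NOp.eval, hSt_X3, hSt_A2AL, hSt_SQ1, hSt_X4, hSt_X6, hSt_A2S, hSt_SFCAND, hSt_X2, hSt_SFE,
      update_hSt_X3, update_hSt_SQ1, update_hSt_X4, update_hSt_X6, update_hSt_SFCAND, update_hSt_X2, ha2al, hx3, hx4, hx6, ha2s, hsfcand, hx2, hsfe, hsq1,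
      bitsToNat_encodeNat, ne_eq, EmbeddingLike.apply_eq_iff_eq, List.length_nil, zero_le, and_self, hlX, hlq, hlXq, hXq0, hlS, hlJ0, hlJr, hwx, hwe, not_false_eq_true]
  · simp [a2PairJ, ha2al, hx3, hx4, hx6, ha2s, hsfcand, hx2, hsfe, hsq1]

/-- **Second part of a pair.** [folklore] -/
theorem runs_a2PairB {N n α a b r m : ℕ} (hN1 : 1 < N) (hn : 2 * (encodeNat N).length + 8 ≤ n) (T : Regs β) (hI : DrvInv (rGH h) N T) (u : HSlots)
    (hαN : α < N) (ha1 : 1 ≤ a) (hb1 : 1 ≤ b) (habr : a * b ≤ r) (hrN : r ≤ N) (hm1 : 1 ≤ m) (hrm : 4 * r * m ≤ N)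
    (hbla : u.bla = encodeNat α) (ha2a : u.a2a = encodeNat a) (ha2b : u.a2b = encodeNat b) (ha2al : u.a2al = encodeNat (4 * r * m)) (ha2s : u.a2s = encodeNat (Nat.sqrt N + 1))
    (hx2 : u.x2 = encodeNat (a * b)) (hsfe : u.sfe = encodeNat (4 * a * b * N)) (hsq1 : u.sq1 = encodeNat (ceilSqrt (4 * a * b * N)))
    (hx3 : u.x3 = []) (hx4 : u.x4 = []) (ha2t : u.a2t = []) (hsfcand : u.sfcand = [])
    (hsq2 : u.sq2 = []) (hsq3 : u.sq3 = []) (hsq4 : u.sq4 = []) (hsq5 : u.sq5 = []) (hx6 : u.x6 = []) :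
    Runs (a2PairB h) (base (hSt h T u)) (base (hSt h T { u with x2 := [], sfe := [], sq1 := [], a2t := encodeNat (α ^ tExp N a b % N), sfcand := encodeNat (jCount N m r a b) }))
      (3028 * (n + 1) ^ 3 + isqrtCost n) := by
  have hN0 : 0 < N := by omega
  have hl := fun (y : ℕ) (hy : y ≤ 4 * N * N) => a2_len4 hN1 hn hy
  have habN : a * b ≤ N := habr.trans hrN
  have haN : a ≤ N := le_trans (Nat.le_mul_of_pos_right _ hb1) habN
  have hbN : b ≤ N := le_trans (Nat.le_mul_of_pos_left _ ha1) habN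
  have hNN : N ≤ 4 * N * N := by nlinarith
  have haNb : a * N + b ≤ 4 * N * N := by nlinarith
  have h1 := runs_a2PairT h (ce := ceilSqrt (4 * a * b * N)) hN1 hn T hI u hαN haNb (ceilSqrt_le N a b) hbla ha2a ha2b hsq1 hx3 hx4 ha2t
  let u1 : HSlots := { u with sq1 := [], a2t := encodeNat (α ^ (a * N + b - ceilSqrt (4 * a * b * N)) % N) }
  have h2 : Runs (isqrtAt h .X2) (base (hSt h T u1)) (base (hSt h T { u1 with sq1 := encodeNat (Nat.sqrt (a * b)) })) (isqrtCost n) :=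
    runs_isqrtAt h (S := .X2) (by decide) (hl _ (habN.trans hNN)) T u1 (by simp [u1, hx2]) (by simp [u1]) (by simp [u1, hsq2]) (by simp [u1, hsq3]) (by simp [u1, hsq4]) (by simp [u1, hsq5])
      (by simp [u1, hx6])
  have hq1 : 1 ≤ Nat.sqrt (a * b) := by rw [Nat.le_sqrt]; nlinarith
  have hqab : Nat.sqrt (a * b) ≤ a * b := Nat.sqrt_le_self _
  have hXq : 4 * r * m * Nat.sqrt (a * b) ≤ 4 * N * N := by nlinarith [habN]
  have hS : Nat.sqrt N + 1 ≤ N := by have := Nat.sqrt_lt_self hN1; omega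
  have h3 := runs_a2PairJ h (q := Nat.sqrt (a * b)) (X := 4 * r * m) (S := Nat.sqrt N + 1) hN1 hn T { u1 with sq1 := encodeNat (Nat.sqrt (a * b)) } hq1 (by nlinarith) hXq hS
    (by simp [u1, ha2al]) (by simp [u1, ha2s]) (by simp) (wx := encodeNat (a * b)) (we := encodeNat (4 * a * b * N)) (by simp [u1, hx2]) (hl _ (habN.trans hNN)) (by simp [u1, hsfe])
    (hl _ (by nlinarith)) (by simp [u1, hx3]) (by simp [u1, hx4]) (by simp [u1, hsfcand]) (by simp [u1, hx6])
  refine (h1.seq (h2.seq h3)).of_eq ?_ (by omega)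
  simp [u1, tExp, jCount]

/-- `w_0 = t·α^{(J*−J+1)m}` on `A2T`. [folklore] -/
def a2PairW : NS β :=
  NS.ofList [.sub (h .X3) (h .A2JJ) (h .SFCAND), .succ (h .X4) (h .X3), .clear (h .X3), .mul (h .X3) (h .X4) (h .A2Y), .clear (h .X4),
    .powMod (h .X4) (h .BLA) (h .X3) (h (.g (.f (.n (.v .MD))))), .clear (h .X3), .mulMod (h .A2T) (h .X4) (h (.g (.f (.n (.v .MD))))), .clear (h .X4)]

/-- `SFR := J − 1`. [folklore] -/
def a2PairR : NS β := NS.ofList [.const (h .X3) [true], .sub (h .SFR) (h .SFCAND) (h .X3), .clear (h .X3)]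

/-- Third part of a pair: the first value, `SFR := J − 1`, the tokens `SFT := 1^J`. [folklore] -/
def a2PairC : Com (EReg ⊕ β) := (a2PairW h).com ;; ((a2PairR h).com ;; nToUnary (h .SFT) (h .SFCAND))

/-- **Third part of a pair**, on abstract operands. [folklore] -/
theorem runs_a2PairC {N n α t J JS m : ℕ} (hN1 : 1 < N) (hn : 2 * (encodeNat N).length + 8 ≤ n) (T : Regs β) (hI : DrvInv (rGH h) N T) (u : HSlots)
    (hαN : α < N) (htN : t < N) (hJ1 : 1 ≤ J) (hJ : J ≤ JS) (hJS : JS ≤ N) (hmN : m ≤ N)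
    (hbla : u.bla = encodeNat α) (ha2t : u.a2t = encodeNat t) (hsfcand : u.sfcand = encodeNat J) (ha2jj : u.a2jj = encodeNat JS) (ha2y : u.a2y = encodeNat m)
    (hx3 : u.x3 = []) (hx4 : u.x4 = []) (hsfr : u.sfr = []) (hsft : u.sft = []) :
    Runs (a2PairC h) (base (hSt h T u))
      (base (hSt h T { u with a2t := encodeNat (t * (α ^ ((JS - J + 1) * m) % N) % N), sfr := encodeNat (J - 1), sft := List.replicate J true }))
      (3343 * (n + 1) ^ 3 + ((encodeNat J).length * (16 * J + 21) + 5)) := by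
  have hN0 : 0 < N := by omega
  obtain ⟨hMD, -, -, -, -, -, -, -, -, -, -, -, -, -, -, -, -, -⟩ := id hI
  have rdMD : ∀ u' : HSlots, hSt h T u' (h (.g (.f (.n (.v .MD))))) = encodeNat N := fun u' => by
    rw [hSt_gv h T u' (by decide) (by decide) (by decide) (by decide) (by decide) (by decide)]; exact hMD
  set c := (n + 1) ^ 3 with hc3
  have hl := fun (y : ℕ) (hy : y ≤ 4 * N * N) => a2_len4 hN1 hn hy
  have hNN : N ≤ 4 * N * N := by nlinarith
  have hk0 : JS - J + 1 ≤ N := by omega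
  have hkm : (JS - J + 1) * m ≤ 4 * N * N := by nlinarith
  have hlN := hl N hNN
  have hlα := hl α (hαN.le.trans hNN)
  have hlt := hl t (htN.le.trans hNN)
  have hlJ := hl J (hJ.trans (hJS.trans hNN))
  have hlJS := hl JS (hJS.trans hNN)
  have hlm := hl m (hmN.trans hNN)
  have hld := hl (JS - J) ((Nat.sub_le _ _).trans (hJS.trans hNN))
  have hlk := hl (JS - J + 1) (hk0.trans hNN)
  have hlkm := hl ((JS - J + 1) * m) hkm
  have hlpw := hl (α ^ ((JS - J + 1) * m) % N) ((Nat.mod_lt _ hN0).le.trans hNN)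
  have hlw := hl (t * (α ^ ((JS - J + 1) * m) % N) % N) ((Nat.mod_lt _ hN0).le.trans hNN)
  have hlJ1 := hl (J - 1) ((Nat.sub_le _ _).trans (hJ.trans (hJS.trans hNN)))
  have e1 : encodeNat 1 = [true] := by simpa using encodeNat_two_pow 0
  have hl1n : (encodeNat 1).length ≤ n := by rw [e1]; simp only [List.length_cons, List.length_nil]; omega
  let u1 : HSlots := { u with a2t := encodeNat (t * (α ^ ((JS - J + 1) * m) % N) % N) }
  have h1 : Runs (a2PairW h).com (base (hSt h T u)) (base (hSt h T u1)) (3265 * c) := by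
    refine NS.runs_of_eq (N := n) _ _ ?_ ?_ (by simp [hc3, a2PairW])
    · simp (config := { decide := true }) only [a2PairW, NS.ofList, NS.ok, NOp.ok, NS.eval, NOp.eval, hSt_X3, hSt_A2JJ, hSt_SFCAND, hSt_X4, hSt_A2Y, hSt_BLA, hSt_A2T,
        update_hSt_X3, update_hSt_X4, update_hSt_A2T, ha2jj, hsfcand, hx3, hx4, ha2y, hbla, ha2t, rdMD, bitsToNat_encodeNat, ne_eq, EmbeddingLike.apply_eq_iff_eq, List.length_nil,
        zero_le, and_self, hlJS, hlJ, hJ, hld, hlk, hlm, hlkm, hlα, hlN, hN1, hN0, hlpw, hlt, not_false_eq_true]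
    · simp [a2PairW, u1, ha2jj, hsfcand, hx3, hx4, ha2y, hbla, ha2t, rdMD]
  let u2 : HSlots := { u1 with sfr := encodeNat (J - 1) }
  have h2 : Runs (a2PairR h).com (base (hSt h T u1)) (base (hSt h T u2)) (78 * c) := by
    refine NS.runs_of_eq (N := n) _ _ ?_ ?_ (by simp [hc3, a2PairR])
    · simp (config := { decide := true }) only [a2PairR, NS.ofList, NS.ok, NOp.ok, NS.eval, NOp.eval, hSt_X3, hSt_SFR, hSt_SFCAND, update_hSt_X3, update_hSt_SFR, u1, hx3, hsfr, hsfcand,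
        bitsToNat_encodeNat, ← e1, List.length_nil, zero_le, and_self, hlJ, hl1n, hJ1]
    · simp [a2PairR, u1, u2, hx3, hsfr, hsfcand, ← e1]
  have h3 : Runs (nToUnary (h .SFT) (h .SFCAND)) (base (hSt h T u2))
      (base (hSt h T { u with a2t := encodeNat (t * (α ^ ((JS - J + 1) * m) % N) % N), sfr := encodeNat (J - 1), sft := List.replicate J true })) ((encodeNat J).length * (16 * J + 21) + 5) := by
    refine (runs_nToUnary (h .SFT) (h .SFCAND) (hSt h T u2) (by simp [u2, u1, hsft])).of_eq (by simp [u2, u1, hsfcand]) ?_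
    simp only [hSt_SFCAND, u2, u1, hsfcand, bitsToNat_encodeNat]; exact le_rfl
  refine (h1.seq (h2.seq h3)).of_eq rfl ?_
  omega

/-- The words of values `g i` with payloads `pl i`, `i < jj`. [folklore] -/
def wordsOf (nb : ℕ) (g : ℕ → ℕ) (pl : ℕ → List Bool) (jj : ℕ) : List (List Bool) := (List.range jj).map fun i => mkWord nb (g i) true (pl i)

/-- `wordsOf` grows by one word. [folklore] -/
theorem wordsOf_succ (nb : ℕ) (g : ℕ → ℕ) (pl : ℕ → List Bool) (jj : ℕ) : wordsOf nb g pl (jj + 1) = wordsOf nb g pl jj ++ [mkWord nb (g jj) true (pl jj)] := by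
  simp [wordsOf, List.range_succ]

/-- `pairWords` as `wordsOf`. [folklore] -/
theorem pairWords_eq_wordsOf (N α m r nb a b jj : ℕ) :
    pairWords N α m r nb a b jj = wordsOf nb (gVal N α m r a b) (fun i => gPayload a b (jCount N m r a b - 1 - i)) jj := rfl

/-- The payload of the current word: `X5 := boolPair a (boolPair b (J−1−jj))`. [folklore] -/
def a2GiantP : NS β :=
  NS.ofList [.sub (h .X5) (h .SFR) (h .A2J), .copy (h .A2B) (h .X6), .pairOnto (h .X6) (h .X5), .copy (h .A2A) (h .X6), .pairOnto (h .X6) (h .X5)]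

/-- After the word: the next value and index. [folklore] -/
def a2GiantN : NS β :=
  NS.ofList [.mulMod (h .A2T) (h .A2AM) (h (.g (.f (.n (.v .MD))))), .succ (h .X4) (h .A2J), .clear (h .A2J), .move (h .X4) (h .A2J)]

/-- One giant-step word. [folklore] -/
def a2GiantRound : Com (EReg ⊕ β) := (a2GiantP h).com ;; (a2Emit h true ;; (a2GiantN h).com)

/-- The state of the word loop of a pair: `i` rounds to go, `jj` words done. [folklore] -/
def HSlots.gwAt (u : HSlots) (nb : ℕ) (g : ℕ → ℕ) (pl : ℕ → List Bool) (ws : List (List Bool)) (i jj : ℕ) : HSlots :=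
  { u with sft := List.replicate i true, a2t := encodeNat (g jj), a2j := encodeNat jj, l4 := outRev (ws ++ wordsOf nb g pl jj), a2l1 := List.replicate (ws ++ wordsOf nb g pl jj).length true }

/-- **One giant-step word**, on abstract operands. [folklore] -/
theorem runs_a2GiantRound {N n a b AM J1 nb i jj : ℕ} (hN1 : 1 < N) (hn : 2 * (encodeNat N).length + 8 ≤ n) (hnb : (encodeNat N).length = nb) (T : Regs β) (hI : DrvInv (rGH h) N T)
    (u : HSlots) (g : ℕ → ℕ) (pl : ℕ → List Bool) (ws : List (List Bool)) (hg : ∀ k, g (k + 1) = g k * AM % N) (hgN : ∀ k, g k < N) (hpl : ∀ k, pl k = gPayload a b (J1 - k))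
    (hAM : AM < N) (hjj : jj ≤ J1) (hJ1 : J1 + 1 ≤ N) (haN : a ≤ N) (hbN : b ≤ N) (hnr : 2 * (encodeNat a).length + 2 * (encodeNat b).length + (encodeNat N).length + 4 ≤ n)
    (ha2a : u.a2a = encodeNat a) (ha2b : u.a2b = encodeNat b) (hsfr : u.sfr = encodeNat J1) (ha2am : u.a2am = encodeNat AM) (ha2d : u.a2d = encodeNat nb)
    (hx5 : u.x5 = []) (hx6 : u.x6 = []) (ha2v : u.a2v = []) (hx2 : u.x2 = []) (hx3 : u.x3 = []) (hx4 : u.x4 = []) (hu2 : u.u2 = []) :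
    Runs (a2GiantRound h) (base (hSt h T { u.gwAt nb g pl ws (i + 1) jj with sft := List.replicate i true })) (base (hSt h T (u.gwAt nb g pl ws i (jj + 1))))
      (1394 * (n + 1) ^ 3) := by
  have hN0 : 0 < N := by omega
  obtain ⟨hMD, -, -, -, -, -, -, -, -, -, -, -, -, -, -, -, -, -⟩ := id hI
  have rdMD : ∀ u' : HSlots, hSt h T u' (h (.g (.f (.n (.v .MD))))) = encodeNat N := fun u' => by
    rw [hSt_gv h T u' (by decide) (by decide) (by decide) (by decide) (by decide) (by decide)]; exact hMD
  set c := (n + 1) ^ 3 with hc3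
  have hlN : (encodeNat N).length ≤ n := by omega
  have hle0 : ∀ y, y ≤ N → (encodeNat y).length ≤ (encodeNat N).length := fun y hy => Brick.length_encodeNat_mono hy
  have hle : ∀ y, y ≤ N → (encodeNat y).length ≤ n := fun y hy => (hle0 y hy).trans hlN
  have hla := hle a haN
  have hlb := hle b hbN
  have hlJ1 := hle J1 (by omega)
  have hljj := hle jj (by omega)
  have hljj1 := hle (jj + 1) (by omega)
  have hlj := hle (J1 - jj) (by omega)
  have hlg := hle (g jj) (hgN jj).le
  have hlg' := hle (g jj * AM % N) (Nat.mod_lt _ hN0).le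
  have hlAM := hle AM hAM.le
  have hlj0 := hle0 (J1 - jj) (by omega)
  have hlp1 : (boolPair (encodeNat b) (encodeNat (J1 - jj))).length ≤ n := by rw [length_boolPair]; omega
  have hlp2 : (gPayload a b (J1 - jj)).length ≤ n := by simp only [gPayload, length_boolPair]; omega
  let v : HSlots := { u with sft := List.replicate i true, a2t := encodeNat (g jj), a2j := encodeNat jj, l4 := outRev (ws ++ wordsOf nb g pl jj), a2l1 := List.replicate (ws ++ wordsOf nb g pl jj).length true }
  have hv : ({ u.gwAt nb g pl ws (i + 1) jj with sft := List.replicate i true } : HSlots) = v := by simp [HSlots.gwAt, v]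
  rw [hv]
  let v1 : HSlots := { v with x5 := gPayload a b (J1 - jj) }
  have h1 : Runs (a2GiantP h).com (base (hSt h T v)) (base (hSt h T v1)) (121 * c) := by
    refine NS.runs_of_eq (N := n) _ _ ?_ ?_ (by simp [hc3, a2GiantP])
    · simp (config := { decide := true }) only [a2GiantP, NS.ofList, NS.ok, NOp.ok, NS.eval, NOp.eval, hSt_X5, hSt_SFR, hSt_A2J, hSt_A2B, hSt_X6, hSt_A2A, update_hSt_X5, update_hSt_X6,
        v, hx5, hsfr, ha2b, hx6, ha2a, bitsToNat_encodeNat, ne_eq, EmbeddingLike.apply_eq_iff_eq, List.length_nil, List.append_nil, zero_le, and_self, hjj, hlJ1, hljj, hlb,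
        hla, not_false_eq_true]
    · simp [a2GiantP, v, v1, hx5, hsfr, ha2b, hx6, ha2a, gPayload]
  have h2 := runs_a2Emit h true (N := N) (v := g jj) hn hnb T v1 (hgN jj) (pl := gPayload a b (J1 - jj)) hlp2 (ws ++ wordsOf nb g pl jj) (by simp [v1, v]) (by simp [v1]) (by simp [v1, v, ha2d])
    (by simp [v1, v]) (by simp [v1, v]) (by simp [v1, v, ha2v]) (by simp [v1, v, hx2]) (by simp [v1, v, hx3]) (by simp [v1, v, hu2])
  let wsg := ws ++ wordsOf nb g pl jj ++ [mkWord nb (g jj) true (gPayload a b (J1 - jj))]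
  let v2 : HSlots := { v1 with x5 := [], l4 := outRev wsg, a2l1 := List.replicate wsg.length true }
  have h3 : Runs (a2GiantN h).com (base (hSt h T v2)) (base (hSt h T (u.gwAt nb g pl ws i (jj + 1)))) (1023 * c) := by
    refine NS.runs_of_eq (N := n) _ _ ?_ ?_ (by simp [hc3, a2GiantN])
    · simp (config := { decide := true }) only [a2GiantN, NS.ofList, NS.ok, NOp.ok, NS.eval, NOp.eval, hSt_A2T, hSt_A2AM, hSt_X4, hSt_A2J, update_hSt_A2T, update_hSt_X4, update_hSt_A2J,
        v2, wsg, v1, v, ha2am, hx4, rdMD, bitsToNat_encodeNat, ne_eq, EmbeddingLike.apply_eq_iff_eq, List.length_nil, zero_le, and_self, hN0, hlg, hlAM, hlN, hljj, hljj1,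
        not_false_eq_true]
    · simp [a2GiantN, v2, wsg, v1, v, HSlots.gwAt, ha2am, hx4, rdMD, hg, wordsOf_succ, hx5, hpl]
  refine (h1.seq (h2.seq h3)).of_eq rfl ?_
  simp only [a2EmitCost, ← hc3]; omega

/-- **The word loop of a pair**: `J` rounds. [folklore] -/
theorem runs_a2GiantLoop {N n a b AM J1 nb : ℕ} (hN1 : 1 < N) (hn : 2 * (encodeNat N).length + 8 ≤ n) (hnb : (encodeNat N).length = nb) (T : Regs β) (hI : DrvInv (rGH h) N T)
    (u : HSlots) (g : ℕ → ℕ) (pl : ℕ → List Bool) (ws : List (List Bool)) (hg : ∀ k, g (k + 1) = g k * AM % N) (hgN : ∀ k, g k < N) (hpl : ∀ k, pl k = gPayload a b (J1 - k))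
    (hAM : AM < N) (hJ1 : J1 + 1 ≤ N) (haN : a ≤ N) (hbN : b ≤ N) (hnr : 2 * (encodeNat a).length + 2 * (encodeNat b).length + (encodeNat N).length + 4 ≤ n)
    (ha2a : u.a2a = encodeNat a) (ha2b : u.a2b = encodeNat b) (hsfr : u.sfr = encodeNat J1) (ha2am : u.a2am = encodeNat AM) (ha2d : u.a2d = encodeNat nb)
    (hx5 : u.x5 = []) (hx6 : u.x6 = []) (ha2v : u.a2v = []) (hx2 : u.x2 = []) (hx3 : u.x3 = []) (hx4 : u.x4 = []) (hu2 : u.u2 = []) :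
    Runs (countLoop (Sum.inr (h .SFT)) (a2GiantRound h)) (base (hSt h T (u.gwAt nb g pl ws (J1 + 1) 0))) (base (hSt h T (u.gwAt nb g pl ws 0 (J1 + 1))))
      ((J1 + 1) * (1394 * (n + 1) ^ 3 + 2) + 1) := by
  have hL := runs_countLoop (U := (Sum.inr (h .SFT) : EReg ⊕ β)) (body := a2GiantRound h) (fun i R => i ≤ J1 + 1 ∧ R = base (hSt h T (u.gwAt nb g pl ws i (J1 + 1 - i)))) (1394 * (n + 1) ^ 3)
    (by
      rintro i R ⟨hi, rfl⟩ -
      have hupd : Function.update (base (hSt h T (u.gwAt nb g pl ws (i + 1) (J1 + 1 - (i + 1))))) (Sum.inr (h .SFT)) (List.replicate i true) =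
          base (hSt h T { u.gwAt nb g pl ws (i + 1) (J1 + 1 - (i + 1)) with sft := List.replicate i true }) := by simp [HSlots.gwAt]
      rw [hupd]
      have hj : J1 + 1 - i = J1 + 1 - (i + 1) + 1 := by omega
      refine ⟨_, runs_a2GiantRound h hN1 hn hnb T hI u g pl ws hg hgN hpl hAM (by omega) hJ1 haN hbN hnr ha2a ha2b hsfr ha2am ha2d hx5 hx6 ha2v hx2 hx3 hx4 hu2,
        by simp [HSlots.gwAt], by omega, by rw [hj]⟩)
    (J1 + 1) (base (hSt h T (u.gwAt nb g pl ws (J1 + 1) 0))) ⟨le_rfl, by simp⟩ (by simp [HSlots.gwAt])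
  obtain ⟨R', hR, -, -, rfl⟩ := hL
  simpa using hR

/-- `J ≤ J*`. [folklore] -/
theorem jCount_le_JStar {N m r a b : ℕ} (ha1 : 1 ≤ a) (hb1 : 1 ≤ b) (hr1 : 1 ≤ r) (hm1 : 1 ≤ m) : jCount N m r a b ≤ a2JStar N m r := by
  have hq1 : 1 ≤ Nat.sqrt (a * b) := by rw [Nat.le_sqrt]; nlinarith
  have hX : 0 < 4 * r * m := by nlinarith
  simp only [jCount, a2JStar]
  have := Nat.div_le_div_left (Nat.le_mul_of_pos_right (4 * r * m) hq1) hX (a := Nat.sqrt N + 1)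
  omega

/-- One pair `(a, b)`: the three parts, the word loop, the clean-up. [folklore] -/
def a2Pair : Com (EReg ⊕ β) :=
  a2PairA h ;; (a2PairB h ;; (a2PairC h ;; (countLoop (Sum.inr (h .SFT)) (a2GiantRound h) ;;
    ((NS.ofList [.clear (h .A2T), .clear (h .A2J), .clear (h .SFCAND), .clear (h .SFR)] : NS β).com))))

/-- Cost of one pair with `J` giant steps. [folklore] -/
def a2PairCost (n J : ℕ) : ℕ := 7534 * (n + 1) ^ 3 + 2 * isqrtCost n + ((encodeNat J).length * (16 * J + 21) + 5) + (J * (1394 * (n + 1) ^ 3 + 2) + 1)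

/-- **One pair `(a, b)`** appends its `J_{a,b}` words. [folklore] -/
theorem runs_a2Pair {N n α a b r m nb : ℕ} (hNodd1 : 1 < N) (hn : 2 * (encodeNat N).length + 8 ≤ n) (hnb : (encodeNat N).length = nb) (T : Regs β) (hI : DrvInv (rGH h) N T) (u : HSlots)
    (hαN : α < N) (ha1 : 1 ≤ a) (hb1 : 1 ≤ b) (habr : a * b ≤ r) (hrN : r ≤ N) (hm1 : 1 ≤ m) (hr1 : 1 ≤ r) (hrm : 4 * r * m ≤ N) (hmN : m ≤ N)
    (hnr : 4 * (encodeNat r).length + (encodeNat N).length + 4 ≤ n) (ws : List (List Bool))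
    (hbla : u.bla = encodeNat α) (ha2a : u.a2a = encodeNat a) (ha2b : u.a2b = encodeNat b) (ha2al : u.a2al = encodeNat (4 * r * m)) (ha2s : u.a2s = encodeNat (Nat.sqrt N + 1))
    (ha2jj : u.a2jj = encodeNat (a2JStar N m r)) (ha2y : u.a2y = encodeNat m) (ha2am : u.a2am = encodeNat (α ^ m % N)) (ha2d : u.a2d = encodeNat nb) (hl4 : u.l4 = outRev ws)
    (ha2l1 : u.a2l1 = List.replicate ws.length true)
    (hx2 : u.x2 = []) (hx3 : u.x3 = []) (hx4 : u.x4 = []) (hx5 : u.x5 = []) (hx6 : u.x6 = []) (hsfe : u.sfe = []) (hfl1 : u.fl1 = [])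
    (hsq1 : u.sq1 = []) (hsq2 : u.sq2 = []) (hsq3 : u.sq3 = []) (hsq4 : u.sq4 = []) (hsq5 : u.sq5 = [])
    (ha2t : u.a2t = []) (hsfcand : u.sfcand = []) (hsfr : u.sfr = []) (hsft : u.sft = []) (ha2j : u.a2j = []) (ha2v : u.a2v = []) (hu2 : u.u2 = []) :
    Runs (a2Pair h) (base (hSt h T u)) (base (hSt h T { u with l4 := outRev (ws ++ pairWords N α m r nb a b (jCount N m r a b)), a2l1 := List.replicate (ws ++ pairWords N α m r nb a b (jCount N m r a b)).length true }))
      (a2PairCost n (jCount N m r a b)) := by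
  have hN1 := hNodd1
  have hN0 : 0 < N := by omega
  set c := (n + 1) ^ 3 with hc3
  have hlN : (encodeNat N).length ≤ n := by omega
  have habN : a * b ≤ N := habr.trans hrN
  have haN : a ≤ N := le_trans (Nat.le_mul_of_pos_right _ hb1) habN
  have hbN : b ≤ N := le_trans (Nat.le_mul_of_pos_left _ ha1) habN
  have hla : (encodeNat a).length ≤ (encodeNat r).length := Brick.length_encodeNat_mono (le_trans (Nat.le_mul_of_pos_right _ hb1) habr)
  have hlb : (encodeNat b).length ≤ (encodeNat r).length := Brick.length_encodeNat_mono (le_trans (Nat.le_mul_of_pos_left _ ha1) habr)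
  obtain ⟨-, -, -, -, hJS, -⟩ := a2Init_sizes hN1 hn hm1 hmN hr1 hrN
  set J := jCount N m r a b with hJ0
  have hJJS : J ≤ a2JStar N m r := jCount_le_JStar ha1 hb1 hr1 hm1
  have hJ1 : 1 ≤ J := by simp [hJ0, jCount]
  set t := α ^ tExp N a b % N with ht0
  have htN : t < N := Nat.mod_lt _ hN0
  -- parts A, B, C
  have h1 := runs_a2PairA h hN1 hn T hI u ha1 hb1 habr hrN ha2a ha2b hx2 hx3 hx4 hsfe hfl1 hsq1 hsq2 hsq3 hsq4 hsq5 hx6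
  let u1 : HSlots := { u with x2 := encodeNat (a * b), sfe := encodeNat (4 * a * b * N), sq1 := encodeNat (ceilSqrt (4 * a * b * N)) }
  have h2 := runs_a2PairB h hN1 hn T hI u1 hαN ha1 hb1 habr hrN hm1 hrm (by simp [u1, hbla]) (by simp [u1, ha2a]) (by simp [u1, ha2b]) (by simp [u1, ha2al]) (by simp [u1, ha2s])
    (by simp [u1]) (by simp [u1]) (by simp [u1]) (by simp [u1, hx3]) (by simp [u1, hx4]) (by simp [u1, ha2t]) (by simp [u1, hsfcand]) (by simp [u1, hsq2]) (by simp [u1, hsq3])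
    (by simp [u1, hsq4]) (by simp [u1, hsq5]) (by simp [u1, hx6])
  let u2 : HSlots := { u1 with x2 := [], sfe := [], sq1 := [], a2t := encodeNat t, sfcand := encodeNat J }
  have h3 := runs_a2PairC h (t := t) (J := J) (JS := a2JStar N m r) (m := m) hN1 hn T hI u2 hαN htN hJ1 hJJS hJS hmN (by simp [u2, u1, hbla]) (by simp [u2]) (by simp [u2])
    (by simp [u2, u1, ha2jj]) (by simp [u2, u1, ha2y]) (by simp [u2, u1, hx3]) (by simp [u2, u1, hx4]) (by simp [u2, u1, hsfr]) (by simp [u2, u1, hsft])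
  -- the loop
  let v : HSlots := { u with sfcand := encodeNat J, sfr := encodeNat (J - 1) }
  set g := gVal N α m r a b with hg0
  set pl : ℕ → List Bool := fun i => gPayload a b (J - 1 - i) with hpl0
  have hg : ∀ k, g (k + 1) = g k * (α ^ m % N) % N := fun k => by simp [hg0, gVal]
  have hgN : ∀ k, g k < N := fun k => by cases k <;> simp [hg0, gVal, gStart] <;> exact Nat.mod_lt _ hN0
  have hstart : ({ u2 with a2t := encodeNat (t * (α ^ ((a2JStar N m r - J + 1) * m) % N) % N), sfr := encodeNat (J - 1), sft := List.replicate J true } : HSlots) = v.gwAt nb g pl ws J 0 := by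
    simp [u2, u1, v, HSlots.gwAt, wordsOf, hg0, gVal, gStart, ← ht0, ← hJ0, ha2j, hl4, ha2l1, hx2, hsfe, hsq1, show encodeNat 0 = [] from rfl]
  have hJeq : J - 1 + 1 = J := by omega
  have h4 := runs_a2GiantLoop h (a := a) (b := b) (AM := α ^ m % N) (J1 := J - 1) hN1 hn hnb T hI v g pl ws hg hgN (fun k => rfl) (Nat.mod_lt _ hN0) (by omega) haN hbN (by omega)
    (by simp [v, ha2a]) (by simp [v, ha2b]) (by simp [v]) (by simp [v, ha2am]) (by simp [v, ha2d]) (by simp [v, hx5]) (by simp [v, hx6]) (by simp [v, ha2v]) (by simp [v, hx2])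
    (by simp [v, hx3]) (by simp [v, hx4]) (by simp [v, hu2])
  rw [hJeq] at h4
  -- clean-up
  have hlg := (Brick.length_encodeNat_mono (hgN J).le).trans hlN
  have hlJ : (encodeNat J).length ≤ n := (Brick.length_encodeNat_mono (hJJS.trans hJS)).trans hlN
  have hlJ1 : (encodeNat (J - 1)).length ≤ n := (Brick.length_encodeNat_mono ((Nat.sub_le _ _).trans (hJJS.trans hJS))).trans hlN
  have h5 : Runs ((NS.ofList [.clear (h .A2T), .clear (h .A2J), .clear (h .SFCAND), .clear (h .SFR)] : NS β).com) (base (hSt h T (v.gwAt nb g pl ws 0 J)))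
      (base (hSt h T { u with l4 := outRev (ws ++ pairWords N α m r nb a b J), a2l1 := List.replicate (ws ++ pairWords N α m r nb a b J).length true })) (12 * c) := by
    refine NS.runs_of_eq (N := n) _ _ ?_ ?_ (by simp [hc3])
    · simp only [NS.ofList, NS.ok, NOp.ok, NS.eval, NOp.eval, hSt_A2T, hSt_A2J, hSt_SFCAND, hSt_SFR, update_hSt_A2T, update_hSt_A2J, update_hSt_SFCAND, HSlots.gwAt, v, List.replicate_zero]
      exact ⟨hlg, hlJ, hlJ, hlJ1, trivial⟩
    · simp [HSlots.gwAt, v, ha2t, ha2j, hsfcand, hsfr, hsft, pairWords_eq_wordsOf, hg0, hpl0, ← hJ0]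
  have h45 : Runs (countLoop (Sum.inr (h .SFT)) (a2GiantRound h) ;; ((NS.ofList [.clear (h .A2T), .clear (h .A2J), .clear (h .SFCAND), .clear (h .SFR)] : NS β).com))
      (base (hSt h T ({ u2 with a2t := encodeNat (t * (α ^ ((a2JStar N m r - J + 1) * m) % N) % N), sfr := encodeNat (J - 1), sft := List.replicate J true } : HSlots)))
      (base (hSt h T { u with l4 := outRev (ws ++ pairWords N α m r nb a b J), a2l1 := List.replicate (ws ++ pairWords N α m r nb a b J).length true })) ((J * (1394 * (n + 1) ^ 3 + 2) + 1) + 12 * c) := by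
    rw [hstart]; exact h4.seq h5
  refine (h1.seq (h2.seq (h3.seq h45))).of_eq rfl ?_
  simp only [a2PairCost, ← hc3]; omega

/-! #### The loops over `b` and `a` -/

/-- One pair of a row: `b := b + 1`, the pair. [folklore] -/
def a2RowBody : Com (EReg ⊕ β) := ((NS.ofList [.succ (h .X3) (h .A2B), .clear (h .A2B), .move (h .X3) (h .A2B)] : NS β).com) ;; a2Pair h

/-- A row `a`: the count `⌊r/a⌋` in unary on `SFK`, the pairs, clean-up. [folklore] -/
def a2Row : Com (EReg ⊕ β) :=
  ((NS.ofList [.divMod (h .X3) (h .X4) (h .A2R) (h .A2A), .clear (h .X4)] : NS β).com) ;; (nToUnary (h .SFK) (h .X3) ;; (((NS.op (.clear (h .X3))) : NS β).com ;;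
  (countLoop (Sum.inr (h .SFK)) (a2RowBody h) ;; ((NS.op (.clear (h .A2B))) : NS β).com)))

/-- The state of a row after `bd` pairs, `i` to go. [folklore] -/
def HSlots.rowAt (u : HSlots) (N α m r nb a : ℕ) (ws : List (List Bool)) (i bd : ℕ) : HSlots :=
  { u with sfk := List.replicate i true, a2b := encodeNat bd, l4 := outRev (ws ++ rowWords N α m r nb a bd), a2l1 := List.replicate (ws ++ rowWords N α m r nb a bd).length true }

/-- The cost of the pairs `b = Bc − k + 1, …` of a row (round `k + 1 → k` handles `b = Bc − k`). [folklore] -/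
def a2RowF (N n m r a Bc : ℕ) (k : ℕ) : ℕ := 83 * (n + 1) ^ 3 + a2PairCost n (jCount N m r a (Bc - k))

/-- **One pair of a row.** [folklore] -/
theorem runs_a2RowBody {N n α a r m nb i bd : ℕ} (hN1 : 1 < N) (hn : 2 * (encodeNat N).length + 8 ≤ n) (hnb : (encodeNat N).length = nb) (T : Regs β) (hI : DrvInv (rGH h) N T) (u : HSlots)
    (hαN : α < N) (ha1 : 1 ≤ a) (habr : a * (bd + 1) ≤ r) (hrN : r ≤ N) (hm1 : 1 ≤ m) (hr1 : 1 ≤ r) (hrm : 4 * r * m ≤ N) (hmN : m ≤ N)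
    (hnr : 4 * (encodeNat r).length + (encodeNat N).length + 4 ≤ n) (ws : List (List Bool))
    (hbla : u.bla = encodeNat α) (ha2a : u.a2a = encodeNat a) (ha2al : u.a2al = encodeNat (4 * r * m)) (ha2s : u.a2s = encodeNat (Nat.sqrt N + 1))
    (ha2jj : u.a2jj = encodeNat (a2JStar N m r)) (ha2y : u.a2y = encodeNat m) (ha2am : u.a2am = encodeNat (α ^ m % N)) (ha2d : u.a2d = encodeNat nb)
    (hx2 : u.x2 = []) (hx3 : u.x3 = []) (hx4 : u.x4 = []) (hx5 : u.x5 = []) (hx6 : u.x6 = []) (hsfe : u.sfe = []) (hfl1 : u.fl1 = [])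
    (hsq1 : u.sq1 = []) (hsq2 : u.sq2 = []) (hsq3 : u.sq3 = []) (hsq4 : u.sq4 = []) (hsq5 : u.sq5 = [])
    (ha2t : u.a2t = []) (hsfcand : u.sfcand = []) (hsfr : u.sfr = []) (hsft : u.sft = []) (ha2j : u.a2j = []) (ha2v : u.a2v = []) (hu2 : u.u2 = []) :
    Runs (a2RowBody h) (base (hSt h T { u.rowAt N α m r nb a ws (i + 1) bd with sfk := List.replicate i true })) (base (hSt h T (u.rowAt N α m r nb a ws i (bd + 1))))
      (83 * (n + 1) ^ 3 + a2PairCost n (jCount N m r a (bd + 1))) := by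
  set c := (n + 1) ^ 3 with hc3
  have hlN : (encodeNat N).length ≤ n := by omega
  have hbr : bd + 1 ≤ r := le_trans (Nat.le_mul_of_pos_left _ ha1) habr
  have hlbd : (encodeNat bd).length ≤ n := (Brick.length_encodeNat_mono (by omega : bd ≤ N)).trans hlN
  have hlbd1 : (encodeNat (bd + 1)).length ≤ n := (Brick.length_encodeNat_mono (hbr.trans hrN)).trans hlN
  let v : HSlots := { u with sfk := List.replicate i true, a2b := encodeNat bd, l4 := outRev (ws ++ rowWords N α m r nb a bd), a2l1 := List.replicate (ws ++ rowWords N α m r nb a bd).length true }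
  have hv : ({ u.rowAt N α m r nb a ws (i + 1) bd with sfk := List.replicate i true } : HSlots) = v := by simp [HSlots.rowAt, v]
  rw [hv]
  let v1 : HSlots := { v with a2b := encodeNat (bd + 1) }
  have h1 : Runs ((NS.ofList [.succ (h .X3) (h .A2B), .clear (h .A2B), .move (h .X3) (h .A2B)] : NS β).com) (base (hSt h T v)) (base (hSt h T v1)) (83 * c) := by
    refine NS.runs_of_eq (N := n) _ _ ?_ (by simp [v, v1, hx3]) (by simp [hc3])
    simp (config := { decide := true }) only [NS.ofList, NS.ok, NOp.ok, NS.eval, NOp.eval, hSt_X3, hSt_A2B, update_hSt_X3, update_hSt_A2B, v, hx3, bitsToNat_encodeNat, ne_eq,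
      EmbeddingLike.apply_eq_iff_eq, List.length_nil, zero_le, and_self, hlbd, hlbd1, not_false_eq_true]
  have h2 := runs_a2Pair h hN1 hn hnb T hI v1 hαN ha1 (by omega) habr hrN hm1 hr1 hrm hmN hnr (ws ++ rowWords N α m r nb a bd) (by simp [v1, v, hbla]) (by simp [v1, v, ha2a]) (by simp [v1])
    (by simp [v1, v, ha2al]) (by simp [v1, v, ha2s]) (by simp [v1, v, ha2jj]) (by simp [v1, v, ha2y]) (by simp [v1, v, ha2am]) (by simp [v1, v, ha2d]) (by simp [v1, v]) (by simp [v1, v])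
    (by simp [v1, v, hx2]) (by simp [v1, v, hx3]) (by simp [v1, v, hx4]) (by simp [v1, v, hx5]) (by simp [v1, v, hx6]) (by simp [v1, v, hsfe]) (by simp [v1, v, hfl1])
    (by simp [v1, v, hsq1]) (by simp [v1, v, hsq2]) (by simp [v1, v, hsq3]) (by simp [v1, v, hsq4]) (by simp [v1, v, hsq5])
    (by simp [v1, v, ha2t]) (by simp [v1, v, hsfcand]) (by simp [v1, v, hsfr]) (by simp [v1, v, hsft]) (by simp [v1, v, ha2j]) (by simp [v1, v, ha2v]) (by simp [v1, v, hu2])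
  refine (h1.seq h2).of_eq ?_ (by omega)
  simp [v1, v, HSlots.rowAt, rowWords]

/-- Cost of a row of `Bc` pairs. [folklore] -/
def a2RowCost (N n m r a Bc : ℕ) : ℕ := 359 * (n + 1) ^ 3 + ((encodeNat Bc).length * (16 * Bc + 21) + 5) + (lsum (a2RowF N n m r a Bc) Bc + 2 * Bc + 1)

/-- **A row `a`**: its `⌊r/a⌋` pairs. [folklore] -/
theorem runs_a2Row {N n α a r m nb : ℕ} (hN1 : 1 < N) (hn : 2 * (encodeNat N).length + 8 ≤ n) (hnb : (encodeNat N).length = nb) (T : Regs β) (hI : DrvInv (rGH h) N T) (u : HSlots)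
    (hαN : α < N) (ha1 : 1 ≤ a) (har : a ≤ r) (hrN : r ≤ N) (hm1 : 1 ≤ m) (hr1 : 1 ≤ r) (hrm : 4 * r * m ≤ N) (hmN : m ≤ N)
    (hnr : 4 * (encodeNat r).length + (encodeNat N).length + 4 ≤ n) (ws : List (List Bool))
    (hbla : u.bla = encodeNat α) (ha2a : u.a2a = encodeNat a) (ha2r : u.a2r = encodeNat r) (ha2al : u.a2al = encodeNat (4 * r * m)) (ha2s : u.a2s = encodeNat (Nat.sqrt N + 1))
    (ha2jj : u.a2jj = encodeNat (a2JStar N m r)) (ha2y : u.a2y = encodeNat m) (ha2am : u.a2am = encodeNat (α ^ m % N)) (ha2d : u.a2d = encodeNat nb) (hl4 : u.l4 = outRev ws)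
    (ha2l1 : u.a2l1 = List.replicate ws.length true) (ha2b : u.a2b = []) (hsfk : u.sfk = [])
    (hx2 : u.x2 = []) (hx3 : u.x3 = []) (hx4 : u.x4 = []) (hx5 : u.x5 = []) (hx6 : u.x6 = []) (hsfe : u.sfe = []) (hfl1 : u.fl1 = [])
    (hsq1 : u.sq1 = []) (hsq2 : u.sq2 = []) (hsq3 : u.sq3 = []) (hsq4 : u.sq4 = []) (hsq5 : u.sq5 = [])
    (ha2t : u.a2t = []) (hsfcand : u.sfcand = []) (hsfr : u.sfr = []) (hsft : u.sft = []) (ha2j : u.a2j = []) (ha2v : u.a2v = []) (hu2 : u.u2 = []) :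
    Runs (a2Row h) (base (hSt h T u)) (base (hSt h T { u with l4 := outRev (ws ++ rowWords N α m r nb a (r / a)), a2l1 := List.replicate (ws ++ rowWords N α m r nb a (r / a)).length true }))
      (a2RowCost N n m r a (r / a)) := by
  have hN0 : 0 < N := by omega
  set c := (n + 1) ^ 3 with hc3
  have hlN : (encodeNat N).length ≤ n := by omega
  have hBcr : r / a ≤ r := Nat.div_le_self _ _
  have haBc : a * (r / a) ≤ r := by rw [mul_comm]; exact Nat.div_mul_le_self r a
  have hlr : (encodeNat r).length ≤ n := (Brick.length_encodeNat_mono hrN).trans hlN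
  have hla : (encodeNat a).length ≤ n := (Brick.length_encodeNat_mono (har.trans hrN)).trans hlN
  have hlBc : (encodeNat (r / a)).length ≤ n := (Brick.length_encodeNat_mono (hBcr.trans hrN)).trans hlN
  have hlrem : (encodeNat (r % a)).length ≤ n := (Brick.length_encodeNat_mono ((Nat.mod_le _ _).trans hrN)).trans hlN
  let u0 : HSlots := { u with x3 := encodeNat (r / a) }
  have h0 : Runs ((NS.ofList [.divMod (h .X3) (h .X4) (h .A2R) (h .A2A), .clear (h .X4)] : NS β).com) (base (hSt h T u)) (base (hSt h T u0)) (353 * c) := by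
    refine NS.runs_of_eq (N := n) _ _ ?_ (by simp [u0, hx4, ha2r, ha2a]) (by simp [hc3])
    simp (config := { decide := true }) only [NS.ofList, NS.ok, NOp.ok, NS.eval, NOp.eval, hSt_X3, hSt_X4, hSt_A2R, hSt_A2A, update_hSt_X3, update_hSt_X4, hx3, hx4, ha2r, ha2a,
      bitsToNat_encodeNat, ne_eq, EmbeddingLike.apply_eq_iff_eq, List.length_nil, zero_le, and_self, hlr, hla, hlrem, not_false_eq_true, true_and, and_true]
    omega
  have hstart : u.rowAt N α m r nb a ws (r / a) 0 = { u0 with x3 := [], sfk := List.replicate (r / a) true } := by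
    simp [HSlots.rowAt, u0, rowWords, ha2b, hl4, ha2l1, hx3, show encodeNat 0 = [] from rfl]
  have h1 : Runs (nToUnary (h .SFK) (h .X3)) (base (hSt h T u0)) (base (hSt h T { u0 with sfk := List.replicate (r / a) true })) ((encodeNat (r / a)).length * (16 * (r / a) + 21) + 5) := by
    refine (runs_nToUnary (h .SFK) (h .X3) (hSt h T u0) (by simp [u0, hsfk])).of_eq (by simp [u0]) ?_
    simp only [hSt_X3, u0, bitsToNat_encodeNat]; exact le_rfl
  have h2 : Runs ((NS.op (.clear (h .X3)) : NS β).com) (base (hSt h T { u0 with sfk := List.replicate (r / a) true })) (base (hSt h T (u.rowAt N α m r nb a ws (r / a) 0))) (3 * c) := by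
    rw [hstart]
    exact NS.runs_of_eq (N := n) _ _ (by simp only [NS.ok, NOp.ok, hSt_X3, u0]; exact hlBc) (by simp [u0]) (by simp [hc3])
  have hL := runs_countLoop_var (U := (Sum.inr (h .SFK) : EReg ⊕ β)) (body := a2RowBody h) (fun i R => i ≤ (r / a) ∧ R = base (hSt h T (u.rowAt N α m r nb a ws i ((r / a) - i)))) (a2RowF N n m r a (r / a))
    (by
      rintro i R ⟨hi, rfl⟩ -
      have hupd : Function.update (base (hSt h T (u.rowAt N α m r nb a ws (i + 1) ((r / a) - (i + 1))))) (Sum.inr (h .SFK)) (List.replicate i true) =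
          base (hSt h T { u.rowAt N α m r nb a ws (i + 1) ((r / a) - (i + 1)) with sfk := List.replicate i true }) := by simp [HSlots.rowAt]
      rw [hupd]
      have hj : (r / a) - i = (r / a) - (i + 1) + 1 := by omega
      have hab : a * ((r / a) - (i + 1) + 1) ≤ r := le_trans (Nat.mul_le_mul_left _ (by omega)) haBc
      refine ⟨_, (runs_a2RowBody h hN1 hn hnb T hI u hαN ha1 hab hrN hm1 hr1 hrm hmN hnr ws hbla ha2a ha2al ha2s ha2jj ha2y ha2am ha2d hx2 hx3 hx4 hx5 hx6 hsfe hfl1 hsq1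
        hsq2 hsq3 hsq4 hsq5 ha2t hsfcand hsfr hsft ha2j ha2v hu2).of_eq rfl (by simp only [a2RowF]; rw [hj]), by simp [HSlots.rowAt], by omega, by rw [hj]⟩)
    (r / a) (base (hSt h T (u.rowAt N α m r nb a ws (r / a) 0))) ⟨le_rfl, by simp⟩ (by simp [HSlots.rowAt])
  obtain ⟨R', hR, -, -, rfl⟩ := hL
  simp only [Nat.sub_zero] at hR
  have hlBr := (Brick.length_encodeNat_mono (hBcr.trans hrN)).trans hlN
  have h3 : Runs ((NS.op (.clear (h .A2B)) : NS β).com) (base (hSt h T (u.rowAt N α m r nb a ws 0 (r / a))))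
      (base (hSt h T { u with l4 := outRev (ws ++ rowWords N α m r nb a (r / a)), a2l1 := List.replicate (ws ++ rowWords N α m r nb a (r / a)).length true })) (3 * c) :=
    NS.runs_of_eq (N := n) _ _ (by simp only [NS.ok, NOp.ok, hSt_A2B, HSlots.rowAt]; exact hlBr) (by simp [HSlots.rowAt, ha2b, hsfk]) (by simp [hc3])
  refine (h0.seq (h1.seq (h2.seq (hR.seq h3)))).of_eq rfl ?_
  simp only [a2RowCost, ← hc3]; omega

/-- One row of the pass: `a := a + 1`, the row. [folklore] -/
def a2GiantsBody : Com (EReg ⊕ β) := ((NS.ofList [.succ (h .X2) (h .A2A), .clear (h .A2A), .move (h .X2) (h .A2A)] : NS β).com) ;; a2Row h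

/-- The giant-step pass: `r` rows. [folklore] -/
def a2Giants : Com (EReg ⊕ β) := nToUnary (h .U1) (h .A2R) ;; (countLoop (Sum.inr (h .U1)) (a2GiantsBody h) ;; ((NS.op (.clear (h .A2A))) : NS β).com)

/-- The state of the pass after `ad` rows, `i` to go. [folklore] -/
def HSlots.gAt (u : HSlots) (N α m r nb : ℕ) (ws : List (List Bool)) (i ad : ℕ) : HSlots :=
  { u with u1 := List.replicate i true, a2a := encodeNat ad, l4 := outRev (ws ++ giantWords N α m r nb ad), a2l1 := List.replicate (ws ++ giantWords N α m r nb ad).length true }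

/-- The cost of the rows (round `k + 1 → k` handles `a = r − k`). [folklore] -/
def a2GiantsF (N n m r : ℕ) (k : ℕ) : ℕ := 83 * (n + 1) ^ 3 + a2RowCost N n m r (r - k) (r / (r - k))

/-- Cost of the giant-step pass. [folklore] -/
def a2GiantsCost (N n m r : ℕ) : ℕ := ((encodeNat r).length * (16 * r + 21) + 5) + (lsum (a2GiantsF N n m r) r + 2 * r + 1) + 3 * (n + 1) ^ 3

/-- **One row of the pass.** [folklore] -/
theorem runs_a2GiantsBody {N n α r m nb i ad : ℕ} (hN1 : 1 < N) (hn : 2 * (encodeNat N).length + 8 ≤ n) (hnb : (encodeNat N).length = nb) (T : Regs β) (hI : DrvInv (rGH h) N T) (u : HSlots)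
    (hαN : α < N) (hadr : ad + 1 ≤ r) (hrN : r ≤ N) (hm1 : 1 ≤ m) (hr1 : 1 ≤ r) (hrm : 4 * r * m ≤ N) (hmN : m ≤ N)
    (hnr : 4 * (encodeNat r).length + (encodeNat N).length + 4 ≤ n) (ws : List (List Bool))
    (hbla : u.bla = encodeNat α) (ha2r : u.a2r = encodeNat r) (ha2al : u.a2al = encodeNat (4 * r * m)) (ha2s : u.a2s = encodeNat (Nat.sqrt N + 1))
    (ha2jj : u.a2jj = encodeNat (a2JStar N m r)) (ha2y : u.a2y = encodeNat m) (ha2am : u.a2am = encodeNat (α ^ m % N)) (ha2d : u.a2d = encodeNat nb)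
    (ha2b : u.a2b = []) (hsfk : u.sfk = [])
    (hx2 : u.x2 = []) (hx3 : u.x3 = []) (hx4 : u.x4 = []) (hx5 : u.x5 = []) (hx6 : u.x6 = []) (hsfe : u.sfe = []) (hfl1 : u.fl1 = [])
    (hsq1 : u.sq1 = []) (hsq2 : u.sq2 = []) (hsq3 : u.sq3 = []) (hsq4 : u.sq4 = []) (hsq5 : u.sq5 = [])
    (ha2t : u.a2t = []) (hsfcand : u.sfcand = []) (hsfr : u.sfr = []) (hsft : u.sft = []) (ha2j : u.a2j = []) (ha2v : u.a2v = []) (hu2 : u.u2 = []) :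
    Runs (a2GiantsBody h) (base (hSt h T { u.gAt N α m r nb ws (i + 1) ad with u1 := List.replicate i true })) (base (hSt h T (u.gAt N α m r nb ws i (ad + 1))))
      (83 * (n + 1) ^ 3 + a2RowCost N n m r (ad + 1) (r / (ad + 1))) := by
  set c := (n + 1) ^ 3 with hc3
  have hlN : (encodeNat N).length ≤ n := by omega
  have hlad : (encodeNat ad).length ≤ n := (Brick.length_encodeNat_mono (by omega : ad ≤ N)).trans hlN
  have hlad1 : (encodeNat (ad + 1)).length ≤ n := (Brick.length_encodeNat_mono (hadr.trans hrN)).trans hlN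
  let v : HSlots := { u with u1 := List.replicate i true, a2a := encodeNat ad, l4 := outRev (ws ++ giantWords N α m r nb ad), a2l1 := List.replicate (ws ++ giantWords N α m r nb ad).length true }
  have hv : ({ u.gAt N α m r nb ws (i + 1) ad with u1 := List.replicate i true } : HSlots) = v := by simp [HSlots.gAt, v]
  rw [hv]
  let v1 : HSlots := { v with a2a := encodeNat (ad + 1) }
  have h1 : Runs ((NS.ofList [.succ (h .X2) (h .A2A), .clear (h .A2A), .move (h .X2) (h .A2A)] : NS β).com) (base (hSt h T v)) (base (hSt h T v1)) (83 * c) := by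
    refine NS.runs_of_eq (N := n) _ _ ?_ (by simp [v, v1, hx2]) (by simp [hc3])
    simp (config := { decide := true }) only [NS.ofList, NS.ok, NOp.ok, NS.eval, NOp.eval, hSt_X2, hSt_A2A, update_hSt_X2, update_hSt_A2A, v, hx2, bitsToNat_encodeNat, ne_eq,
      EmbeddingLike.apply_eq_iff_eq, List.length_nil, zero_le, and_self, hlad, hlad1, not_false_eq_true]
  have h2 := runs_a2Row h hN1 hn hnb T hI v1 hαN (by omega) hadr hrN hm1 hr1 hrm hmN hnr (ws ++ giantWords N α m r nb ad) (by simp [v1, v, hbla]) (by simp [v1]) (by simp [v1, v, ha2r])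
    (by simp [v1, v, ha2al]) (by simp [v1, v, ha2s]) (by simp [v1, v, ha2jj]) (by simp [v1, v, ha2y]) (by simp [v1, v, ha2am]) (by simp [v1, v, ha2d]) (by simp [v1, v])
    (by simp [v1, v]) (by simp [v1, v, ha2b]) (by simp [v1, v, hsfk])
    (by simp [v1, v, hx2]) (by simp [v1, v, hx3]) (by simp [v1, v, hx4]) (by simp [v1, v, hx5]) (by simp [v1, v, hx6]) (by simp [v1, v, hsfe]) (by simp [v1, v, hfl1])
    (by simp [v1, v, hsq1]) (by simp [v1, v, hsq2]) (by simp [v1, v, hsq3]) (by simp [v1, v, hsq4]) (by simp [v1, v, hsq5])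
    (by simp [v1, v, ha2t]) (by simp [v1, v, hsfcand]) (by simp [v1, v, hsfr]) (by simp [v1, v, hsft]) (by simp [v1, v, ha2j]) (by simp [v1, v, ha2v]) (by simp [v1, v, hu2])
  refine (h1.seq h2).of_eq ?_ (by omega)
  simp [v1, v, HSlots.gAt, giantWords]

/-- **The giant-step pass**: all pairs `(a, b)`, `ab ≤ r`. [folklore] -/
theorem runs_a2Giants {N n α r m nb : ℕ} (hN1 : 1 < N) (hn : 2 * (encodeNat N).length + 8 ≤ n) (hnb : (encodeNat N).length = nb) (T : Regs β) (hI : DrvInv (rGH h) N T) (u : HSlots)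
    (hαN : α < N) (hrN : r ≤ N) (hm1 : 1 ≤ m) (hr1 : 1 ≤ r) (hrm : 4 * r * m ≤ N) (hmN : m ≤ N)
    (hnr : 4 * (encodeNat r).length + (encodeNat N).length + 4 ≤ n) (ws : List (List Bool))
    (hbla : u.bla = encodeNat α) (ha2r : u.a2r = encodeNat r) (ha2al : u.a2al = encodeNat (4 * r * m)) (ha2s : u.a2s = encodeNat (Nat.sqrt N + 1))
    (ha2jj : u.a2jj = encodeNat (a2JStar N m r)) (ha2y : u.a2y = encodeNat m) (ha2am : u.a2am = encodeNat (α ^ m % N)) (ha2d : u.a2d = encodeNat nb) (hl4 : u.l4 = outRev ws)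
    (ha2l1 : u.a2l1 = List.replicate ws.length true) (ha2a : u.a2a = []) (hu1 : u.u1 = []) (ha2b : u.a2b = []) (hsfk : u.sfk = [])
    (hx2 : u.x2 = []) (hx3 : u.x3 = []) (hx4 : u.x4 = []) (hx5 : u.x5 = []) (hx6 : u.x6 = []) (hsfe : u.sfe = []) (hfl1 : u.fl1 = [])
    (hsq1 : u.sq1 = []) (hsq2 : u.sq2 = []) (hsq3 : u.sq3 = []) (hsq4 : u.sq4 = []) (hsq5 : u.sq5 = [])
    (ha2t : u.a2t = []) (hsfcand : u.sfcand = []) (hsfr : u.sfr = []) (hsft : u.sft = []) (ha2j : u.a2j = []) (ha2v : u.a2v = []) (hu2 : u.u2 = []) :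
    Runs (a2Giants h) (base (hSt h T u)) (base (hSt h T { u with l4 := outRev (ws ++ giantWords N α m r nb r), a2l1 := List.replicate (ws ++ giantWords N α m r nb r).length true })) (a2GiantsCost N n m r) := by
  set c := (n + 1) ^ 3 with hc3
  have hlN : (encodeNat N).length ≤ n := by omega
  have hlr : (encodeNat r).length ≤ n := (Brick.length_encodeNat_mono hrN).trans hlN
  have hstart : u.gAt N α m r nb ws r 0 = { u with u1 := List.replicate r true } := by
    simp [HSlots.gAt, giantWords, ha2a, hl4, ha2l1, show encodeNat 0 = [] from rfl]
  have h1 : Runs (nToUnary (h .U1) (h .A2R)) (base (hSt h T u)) (base (hSt h T (u.gAt N α m r nb ws r 0))) ((encodeNat r).length * (16 * r + 21) + 5) := by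
    refine (runs_nToUnary (h .U1) (h .A2R) (hSt h T u) (by rw [hSt_U1]; exact hu1)).of_eq (by rw [hstart]; simp [ha2r]) ?_
    simp only [hSt_A2R, ha2r, bitsToNat_encodeNat]; exact le_rfl
  have hL := runs_countLoop_var (U := (Sum.inr (h .U1) : EReg ⊕ β)) (body := a2GiantsBody h) (fun i R => i ≤ r ∧ R = base (hSt h T (u.gAt N α m r nb ws i (r - i)))) (a2GiantsF N n m r)
    (by
      rintro i R ⟨hi, rfl⟩ -
      have hupd : Function.update (base (hSt h T (u.gAt N α m r nb ws (i + 1) (r - (i + 1))))) (Sum.inr (h .U1)) (List.replicate i true) =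
          base (hSt h T { u.gAt N α m r nb ws (i + 1) (r - (i + 1)) with u1 := List.replicate i true }) := by simp [HSlots.gAt]
      rw [hupd]
      have hj : r - i = r - (i + 1) + 1 := by omega
      refine ⟨_, (runs_a2GiantsBody h hN1 hn hnb T hI u hαN (by omega) hrN hm1 hr1 hrm hmN hnr ws hbla ha2r ha2al ha2s ha2jj ha2y ha2am ha2d ha2b hsfk hx2 hx3 hx4 hx5 hx6 hsfe hfl1
        hsq1 hsq2 hsq3 hsq4 hsq5 ha2t hsfcand hsfr hsft ha2j ha2v hu2).of_eq rfl (by simp only [a2GiantsF]; rw [hj]), by simp [HSlots.gAt], by omega, by rw [hj]⟩)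
    r (base (hSt h T (u.gAt N α m r nb ws r 0))) ⟨le_rfl, by simp⟩ (by simp [HSlots.gAt])
  obtain ⟨R', hR, -, -, rfl⟩ := hL
  simp only [Nat.sub_zero] at hR
  have h3 : Runs ((NS.op (.clear (h .A2A)) : NS β).com) (base (hSt h T (u.gAt N α m r nb ws 0 r)))
      (base (hSt h T { u with l4 := outRev (ws ++ giantWords N α m r nb r), a2l1 := List.replicate (ws ++ giantWords N α m r nb r).length true })) (3 * c) :=
    NS.runs_of_eq (N := n) _ _ (by simp only [NS.ok, NOp.ok, hSt_A2A, HSlots.gAt]; exact hlr) (by simp [HSlots.gAt, ha2a, hu1]) (by simp [hc3])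
  refine (h1.seq (hR.seq h3)).of_eq rfl ?_
  simp only [a2GiantsCost, ← hc3]; omega

end AlgTwoGiant


section AlgTwoSort

/-! #### Step 3: sorting the words by value (the radix sorter of `StackRadixSort.lean` grafted onto `RX1 … RX9`, `A2SRT`) -/

/-- The bank assignment of the sorter. [folklore] -/
def rMap : RReg → HReg
  | .L => .RX1 | .A => .RX2 | .z => .RX3 | .o => .RX4 | .w => .RX5 | .t => .RX6 | .U => .RX7 | .V => .RX8 | .p => .RX9 | .W => .A2SRT

/-- `rMap` is injective. [folklore] -/
theorem rMap_injective : Function.Injective rMap := by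
  intro a b hab; cases a <;> cases b <;> simp only [rMap] at hab <;> first | rfl | exact absurd hab (by decide)

/-- Grafting along `Sum.inr ∘ g` into a `base` file. [folklore] -/
theorem graft_base_inr {ρ β' : Type} {g : ρ → β'} (hg : Function.Injective g) (T : Regs β') (F' : Regs ρ) :
    graft (base T) (Sum.inr ∘ g) F' = base (graft T g F') := by
  have hinj : Function.Injective (Sum.inr ∘ g : ρ → EReg ⊕ β') := Sum.inr_injective.comp hg
  funext k
  rcases k with e | b
  · rw [graft_of_not _ _ _ (fun i => by simp)]; rfl
  · by_cases hb : ∃ r, g r = b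
    · obtain ⟨r, rfl⟩ := hb
      rw [show (Sum.inr (g r) : EReg ⊕ β') = (Sum.inr ∘ g) r from rfl, graft_apply _ hinj]
      change F' r = graft T g F' (g r)
      rw [graft_apply _ hg]
    · have hb' : ∀ r, g r ≠ b := fun r h => hb ⟨r, h⟩
      rw [graft_of_not _ _ _ (fun i => by simpa using hb' i)]
      change T b = graft T g F' b
      rw [graft_of_not _ _ _ hb']

/-- The sorter at the call site. [folklore] -/
def sortAt : Com (EReg ⊕ β) := Radix.sortProg.map (Sum.inr ∘ h ∘ rMap)

/-- **The sorter at the call site**: `RX1 := encList (radixIter l k)` for `RX1 = encList l`, `A2SRT = 1^k`; `RX7 := 1^k`. [folklore] -/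
theorem runs_sortAt (k : ℕ) (l : List (List Bool)) (T : Regs β) (u : HSlots) (hrx1 : u.rx1 = encList l) (ha2srt : u.a2srt = List.replicate k true)
    (hrx2 : u.rx2 = []) (hrx3 : u.rx3 = []) (hrx4 : u.rx4 = []) (hrx5 : u.rx5 = []) (hrx6 : u.rx6 = []) (hrx7 : u.rx7 = []) (hrx8 : u.rx8 = []) (hrx9 : u.rx9 = []) :
    Runs (sortAt h) (base (hSt h T u)) (base (hSt h T { u with rx1 := encList (radixIter l k), rx7 := List.replicate k true, a2srt := [] })) (k * (Radix.passCost k l + 3) + 1) := by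
  have hinj : Function.Injective (h ∘ rMap) := h.injective.comp rMap_injective
  have hinj' : Function.Injective (Sum.inr ∘ h ∘ rMap : RReg → EReg ⊕ β) := Sum.inr_injective.comp hinj
  let ρ : RRF := ⟨encList l, [], [], [], [], [], [], [], [], List.replicate k true⟩
  have hr := Runs.map (f := (Sum.inr ∘ h ∘ rMap : RReg → EReg ⊕ β)) hinj' (Radix.runs_sortProg k l ρ rfl rfl rfl rfl rfl rfl rfl rfl rfl rfl) (base (hSt h T u)) (fun i => by
    cases i <;> simp [rMap, RRF.regs, ρ, hrx1, ha2srt, hrx2, hrx3, hrx4, hrx5, hrx6, hrx7, hrx8, hrx9])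
  rw [show (Sum.inr ∘ h ∘ rMap : RReg → EReg ⊕ β) = Sum.inr ∘ (h ∘ rMap) from rfl, graft_base_inr hinj] at hr
  refine hr.of_eq ?_ le_rfl
  have hupd : hSt h T { u with rx1 := encList (radixIter l k), rx7 := List.replicate k true, a2srt := [] } =
      Function.update (Function.update (Function.update (hSt h T u) (h .RX1) (encList (radixIter l k))) (h .RX7) (List.replicate k true)) (h .A2SRT) [] := by
    rw [update_hSt_RX1, update_hSt_RX7, update_hSt_A2SRT]
  rw [hupd]
  congr 1
  funext r
  by_cases hr' : ∃ i, (h ∘ rMap) i = r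
  · obtain ⟨i, rfl⟩ := hr'
    rw [graft_apply _ hinj]
    cases i <;> simp [rMap, RRF.regs, ρ, hq_ne h, hrx2, hrx3, hrx4, hrx5, hrx6, hrx8, hrx9]
  · have hne : ∀ i, (h ∘ rMap) i ≠ r := fun i hi => hr' ⟨i, hi⟩
    have h1 : r ≠ h .RX1 := fun hh => hne .L (by simp [rMap, hh])
    have h7 : r ≠ h .RX7 := fun hh => hne .U (by simp [rMap, hh])
    have hW : r ≠ h .A2SRT := fun hh => hne .W (by simp [rMap, hh])
    rw [graft_of_not _ _ _ hne, Function.update_of_ne hW, Function.update_of_ne h7, Function.update_of_ne h1]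

end AlgTwoSort

section AlgTwoSortPass

/-- The sorting pass: the words onto `RX1`, `nb` passes of the radix sorter, clean-up. [folklore] -/
def a2Sort : Com (EReg ⊕ β) :=
  pour (Sum.inr (h .L4)) (Sum.inr (h .RX1)) ;; (((NS.op (.copy (h .A2U) (h .A2SRT))) : NS β).com ;; (sortAt h ;; clear (Sum.inr (h .RX7))))

/-- Cost of the sorting pass. [folklore] -/
def a2SortCost (n nb : ℕ) (ws : List (List Bool)) : ℕ := 3 * (encList ws).length + 1 + 13 * (n + 1) ^ 3 + (nb * (Radix.passCost nb ws + 3) + 1) + (2 * nb + 1)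

/-- **The sorting pass.** [folklore] -/
theorem runs_a2Sort {n nb : ℕ} (hnbn : nb ≤ n) (ws : List (List Bool)) (T : Regs β) (u : HSlots) (hl4 : u.l4 = outRev ws) (ha2u : u.a2u = List.replicate nb true)
    (hrx1 : u.rx1 = []) (ha2srt : u.a2srt = []) (hrx2 : u.rx2 = []) (hrx3 : u.rx3 = []) (hrx4 : u.rx4 = []) (hrx5 : u.rx5 = []) (hrx6 : u.rx6 = []) (hrx7 : u.rx7 = []) (hrx8 : u.rx8 = [])
    (hrx9 : u.rx9 = []) :
    Runs (a2Sort h) (base (hSt h T u)) (base (hSt h T { u with l4 := [], rx1 := encList (radixIter ws nb) })) (a2SortCost n nb ws) := by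
  have hrev : (outRev ws).reverse = encList ws := reverse_outRev ws
  have hlo : (outRev ws).length = (encList ws).length := by rw [← hrev, List.length_reverse]
  let u1 : HSlots := { u with l4 := [], rx1 := encList ws }
  have h1 : Runs (pour (Sum.inr (h .L4)) (Sum.inr (h .RX1))) (base (hSt h T u)) (base (hSt h T u1)) (3 * (encList ws).length + 1) := by
    refine (runs_opour (a := h .L4) (b := h .RX1) (hq_ne h (by decide)) (hSt h T u)).of_eq ?_ ?_
    · simp [u1, hl4, hrx1, hrev]
    · simp only [hSt_L4, hl4, hlo]; exact le_rfl
  let u2 : HSlots := { u1 with a2srt := List.replicate nb true }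
  have h2 : Runs ((NS.op (.copy (h .A2U) (h .A2SRT)) : NS β).com) (base (hSt h T u1)) (base (hSt h T u2)) (13 * (n + 1) ^ 3) := by
    refine NS.runs_of_eq (N := n) _ _ ?_ (by simp [u1, u2, ha2u, ha2srt]) (by simp)
    simp (config := { decide := true }) only [NS.ok, NOp.ok, hSt_A2U, u1, ha2u, List.length_replicate, ne_eq, EmbeddingLike.apply_eq_iff_eq, not_false_eq_true, true_and]; exact hnbn
  have h3 := runs_sortAt h nb ws T u2 (by simp [u2, u1]) (by simp [u2]) (by simp [u2, u1, hrx2]) (by simp [u2, u1, hrx3]) (by simp [u2, u1, hrx4]) (by simp [u2, u1, hrx5]) (by simp [u2, u1, hrx6])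
    (by simp [u2, u1, hrx7]) (by simp [u2, u1, hrx8]) (by simp [u2, u1, hrx9])
  let u3 : HSlots := { u2 with rx1 := encList (radixIter ws nb), rx7 := List.replicate nb true, a2srt := [] }
  have h4 : Runs (clear (Sum.inr (h .RX7))) (base (hSt h T u3)) (base (hSt h T { u with l4 := [], rx1 := encList (radixIter ws nb) })) (2 * nb + 1) := by
    refine (runs_clear (Sum.inr (h .RX7)) (base (hSt h T u3))).of_eq (by simp [u3, u2, u1, hrx7, ha2srt]) ?_
    simp only [nst_inr, hSt_RX7, u3, List.length_replicate]; exact le_rfl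
  refine (h1.seq (h2.seq (h3.seq h4))).of_eq rfl ?_
  simp only [a2SortCost]; omega

end AlgTwoSortPass

end Com

end Literature.Computability.Complexity
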